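import Literature.AlgebraicGeometry.Resolution.TameDescent
import Literature.AlgebraicGeometry.Resolution.TameRootLayers
import Literature.AlgebraicGeometry.Resolution.HenselianRationalityPerfectSplit
import Literature.AlgebraicGeometry.Resolution.ResidueTranscendentalExtensions
import Literature.AlgebraicGeometry.Resolution.Kuhlmann2019Lemma54Proofs
import Literature.AlgebraicGeometry.Resolution.KrasnerHenselian
import Literature.AlgebraicGeometry.Resolution.SeparatingElementCriterion
import Literature.AlgebraicGeometry.Resolution.HenselizationDirectedUnion
import Literature.AlgebraicGeometry.Resolution.ImmediateRationalUniformization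
import Literature.AlgebraicGeometry.Resolution.DiscCutoutForms
import Literature.AlgebraicGeometry.Resolution.KaplanskyUnitForms
import Literature.AlgebraicGeometry.Resolution.DeeplyRamifiedConjugates
import Literature.AlgebraicGeometry.Resolution.OstrowskiRamification
import Literature.AlgebraicGeometry.Resolution.GeneralizedStabilityRankOneVT
import Mathlib.FieldTheory.Galois.Basic
import Mathlib.FieldTheory.AlgebraicClosure
import HarnessLib

/-!
# Deep centres for the generator of a henselian-rational function field, at a finite level

Topic: `Literature/AlgebraicGeometry/Resolution` (valued function fields). Valuation-theoretic
input for the algebraization step (Steps 2–3) of M. Temkin, *Inseparable local uniformization*,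
J. Algebra 373 (2013) 65–119 = arXiv:0804.1554v3, **Thm. 3.3.1** (tree: the named fact
`Temkin2013RelativeCurveSmoothFibre`, reduced by `Temkin2013RelativeCurveSmoothFibre.of_chartData`,
`DChartRoof.lean`, to the existence of chart data `RelCurveChart` + `EData`). The E-data ask for
a DEEP `m`-rational disc `|X − a| ≤ |c|` through the generator `x` on which finitely many
polynomials have Kaplansky UNIT FORMS (`KaplanskyUnitForms.lean`, `DiscChartCoefficients.lean`).
`exists_unitForm` derives unit forms from Kaplansky's hypotheses (`(m(x)|m)` immediate of
transcendental approximation type), which FAIL in general over a finitely generated constant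
field `m` (the value group of `m(x)` may be infinitely generated over that of `m`). What holds,
and is proved here, is the following (Temkin's route: Thm. 3.2.3, Step 2 — work over the
relatively algebraically closed, perfect, henselian base first — then Thm. 3.2.6, Step 2 and
Lemma 3.2.7 — descend to a finite level):

* `exists_unitForm_of_forall_isRoot` — **unit forms from root separation**: a polynomial `h`
  over `m` none of whose roots lies in the closed disc `|X − a| ≤ |c|` (`a, c ∈ m`) has a unit
  form `h(x) = h(a) · U((x − a)/c)` at `(a, c)`, `U` a `1`-unit polynomial over `m` — the format
  of `exists_unitForm`, with no hypothesis on the approximation type (`oneUnit_of_forall_isRoot`: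
  a polynomial with constant coefficient `1` and all roots of value `> 1` is a `1`-unit) — PROVED;
* `exists_mem_valuation_sub_lt_of_isAlgebraic`, `exists_deep_centre` — over a field `K` over
  which `x` satisfies Kaplansky's hypotheses, **no algebraic element approximates `x` as well as
  `K` does**, hence for every finite set `R` of algebraic elements there is a `K`-rational disc
  `|X − a| ≤ |c|` through `x` (`|x − a| = |c|`), as deep as we please, avoiding `R` — PROVED;
* `exists_perfect_split_base`, `kaplansky_of_perfect_split_base` — in characteristic `p`, for
  `k ≤ F ≤ (Ω, V)` with `k` of rank one, `|F^×|/|k^×|` torsion and `F̃/k̃` algebraic: the base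
  `C = (F·k^{1/p^∞})^h ∩ k̃` is perfect, henselian, of rank one, algebraically closed in
  `E = (F·k^{1/p^∞})^h` with `(E|C)` immediate, and every `x ∈ E` transcendental over `k`
  satisfies Kaplansky's hypotheses over `C` (Temkin's Cor. 3.1.10, tree `kaplansky_of_split`)
  — PROVED;
* `exists_finset_isSeparable_closure`, `exists_finset_level_of_subset_split_base` — finitely
  many elements of `C` are, at one finite purely inseparable level `k(r) ⊆ k^{1/p^∞}`,
  SEPARABLE constants lying in the henselization of `F·k(r)` — PROVED;
* `exists_deep_separable_centre_charP` — **the assembly**: for `x ∈ F` transcendental over `k`,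
  a finite set `R` of elements algebraic over `k` and `a₀ ∈ k`, there are a finite
  `r ⊆ k^{1/p^∞}` and constants `a, c`, algebraic over `k`, separable over `k(r)` and lying in
  `(F·k(r))^h`, with `|x − a| = |c| < |x − a₀|` and `|c| < |x − ρ|`, `|c| < |a − ρ| = |x − ρ|`
  for all `ρ ∈ R` — PROVED;
* `exists_krasnerGood_of_perfect` — **Krasner-good centres** (the algebraic content of Temkin's
  Cor. 3.1.9 with Lemma 3.1.3 and Prop. 3.1.7): over a perfect henselian `K` of rank one, an
  approximant `a` of `x` with `|x − a| < |g|` can be replaced by one, `a′`, with `|x − a′| < |g|`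
  and `|x − a′| < |a′ − ρ|` for every `K`-conjugate `ρ ≠ a′` — induction on the degree through the
  fixed field of the subgroup of automorphisms moving `a` by at most `|x − a|` — PROVED;
* `exists_mem_perfectHull_valuation_between` — the values of `k^{1/p^∞}` are dense (radii) —
  PROVED;
* `exists_disc_constants_charP` — **the disc constants at a finite level**: centre `a` (separable
  constant in `(F·k(r))^h`), radius `c ∈ k(r)` purely inseparable, and the minimal polynomial `P`
  of `a` over `(k^{1/p^∞})^h` with henselian-constant coefficients at the level, with
  `|x − a| < |c| < |a − ρ|` for all roots `ρ ≠ a` of `P` (the disc is split for its centre: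
  Newton's iteration for `P` from `x` converges to `a` uniformly on the disc), `|c|` below `a₀`'s
  depth and avoiding `R` — PROVED.

No definitions, no named facts.

## Sources

* M. Temkin, arXiv:0804.1554v3: Lemma 3.1.3, Prop. 3.1.7, Cor. 3.1.9, Cor. 3.1.10, Thm. 3.2.3
  (proof, Step 2), Thm. 3.2.4 (proof, type 4), Thm. 3.2.6 (proof, Steps 1–2), Lemma 3.2.7,
  Thm. 3.3.1 (proof, Steps 2–3) (pp. 20–22 and 41–45 of the held arXiv text). [Temkin2013]
* F.-V. Kuhlmann, I. Vlahu, Math. Z. 276 (2014) = arXiv:1304.0200, §7 (approximation types,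
  Kaplansky's hypotheses), through the tree. [KuhlmannVlahu2014]
* I. Kaplansky, *Maximal fields with valuations*, Duke Math. J. 9 (1942), Lemmas 4–5 and
  Thm. 1 (pseudo-convergent sequences of transcendental type), through the tree
  (`ImmediateRationalUniformization.lean`). [folklore]
-/

noncomputable section

open Polynomial IsLocalRing

namespace Literature.AlgebraicGeometry.Resolution

universe u

variable {Ω : Type u} [Field Ω] (V : ValuationSubring Ω)

/-! ### `1`-unit polynomials -/

section OneUnit

/-- The product of two `1`-unit polynomials (constant coefficient `1`, higher coefficients of
value `< 1`) is a `1`-unit polynomial. [folklore] -/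
theorem oneUnit_mul {P Q : Polynomial Ω} (hP0 : P.coeff 0 = 1)
    (hP : ∀ i, 1 ≤ i → V.valuation (P.coeff i) < 1) (hQ0 : Q.coeff 0 = 1)
    (hQ : ∀ i, 1 ≤ i → V.valuation (Q.coeff i) < 1) :
    (P * Q).coeff 0 = 1 ∧ ∀ i, 1 ≤ i → V.valuation ((P * Q).coeff i) < 1 := by
  have hPle : ∀ i, V.valuation (P.coeff i) ≤ 1 := fun i => by
    rcases Nat.eq_zero_or_pos i with rfl | hi
    · rw [hP0, map_one]
    · exact (hP i hi).le
  have hQle : ∀ i, V.valuation (Q.coeff i) ≤ 1 := fun i => by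
    rcases Nat.eq_zero_or_pos i with rfl | hi
    · rw [hQ0, map_one]
    · exact (hQ i hi).le
  refine ⟨by rw [mul_coeff_zero, hP0, hQ0, mul_one], fun i hi => ?_⟩
  rw [coeff_mul]
  refine Valuation.map_sum_lt _ one_ne_zero fun ab hab => ?_
  have hsum : ab.1 + ab.2 = i := Finset.mem_antidiagonal.mp hab
  rw [map_mul]
  rcases Nat.eq_zero_or_pos ab.1 with h1 | h1
  · have h2 : 1 ≤ ab.2 := by omega
    calc V.valuation (P.coeff ab.1) * V.valuation (Q.coeff ab.2)
        ≤ 1 * V.valuation (Q.coeff ab.2) := mul_le_mul_left (hPle _) _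
      _ < 1 := by rw [one_mul]; exact hQ _ h2
  · calc V.valuation (P.coeff ab.1) * V.valuation (Q.coeff ab.2)
        ≤ V.valuation (P.coeff ab.1) * 1 := mul_le_mul_right (hQle _) _
      _ < 1 := by rw [mul_one]; exact hP _ h1

/-- The linear `1`-unit polynomial `1 - r⁻¹ X` for `|r| > 1`. [folklore] -/
theorem oneUnit_linear {r : Ω} (hr : 1 < V.valuation r) :
    (1 - C r⁻¹ * X : Polynomial Ω).coeff 0 = 1 ∧
      ∀ i, 1 ≤ i → V.valuation ((1 - C r⁻¹ * X : Polynomial Ω).coeff i) < 1 := by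
  refine ⟨by simp, fun i hi => ?_⟩
  have hr0 : r ≠ 0 := by rintro rfl; rw [map_zero] at hr; exact not_lt_zero hr
  rcases Nat.lt_or_ge 1 i with h2 | h2
  · have : (1 - C r⁻¹ * X : Polynomial Ω).coeff i = 0 := by
      rw [coeff_sub, coeff_one, coeff_C_mul, coeff_X]
      simp [show i ≠ 0 by omega, show (1 : ℕ) ≠ i by omega]
    rw [this, map_zero]; exact zero_lt_one
  · obtain rfl : i = 1 := le_antisymm h2 hi
    have : (1 - C r⁻¹ * X : Polynomial Ω).coeff 1 = -r⁻¹ := by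
      rw [coeff_sub, coeff_one, coeff_C_mul, coeff_X]; simp
    rw [this, Valuation.map_neg, map_inv₀, inv_lt_one₀ (lt_trans zero_lt_one hr)]
    exact hr

variable [IsAlgClosed Ω]

/-- **A polynomial with constant coefficient `1` all of whose roots have value `> 1` is a
`1`-unit polynomial** (`U = ∏ (1 - X/rᵢ)`, `|1/rᵢ| < 1`). [folklore] -/
theorem oneUnit_of_forall_isRoot :
    ∀ (n : ℕ) (U : Polynomial Ω), U.natDegree ≤ n → U.coeff 0 = 1 →
      (∀ r : Ω, U.IsRoot r → 1 < V.valuation r) →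
      ∀ i, 1 ≤ i → V.valuation (U.coeff i) < 1 := by
  intro n
  induction n with
  | zero =>
    intro U hdeg hU0 _ i hi
    rw [coeff_eq_zero_of_natDegree_lt (by omega), map_zero]
    exact zero_lt_one
  | succ n ih =>
    intro U hdeg hU0 hroots i hi
    by_cases hd : U.natDegree = 0
    · rw [coeff_eq_zero_of_natDegree_lt (by omega), map_zero]
      exact zero_lt_one
    -- a root `r`, `|r| > 1`
    have hU0' : U ≠ 0 := fun h => by rw [h, coeff_zero] at hU0; exact zero_ne_one hU0
    have hdeg' : U.degree ≠ 0 := fun h => hd (natDegree_eq_of_degree_eq_some h)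
    obtain ⟨r, hr⟩ := IsAlgClosed.exists_root U hdeg'
    have hvr : 1 < V.valuation r := hroots r hr
    have hr0 : r ≠ 0 := by rintro rfl; rw [map_zero] at hvr; exact not_lt_zero hvr
    -- `U = (1 - r⁻¹ X) · Q'`, `Q' = -r · (U /ₘ (X - r))`
    set Q : Polynomial Ω := U /ₘ (X - C r) with hQ
    have hUQ : (X - C r) * Q = U := mul_divByMonic_eq_iff_isRoot.mpr hr
    set Q' : Polynomial Ω := C (-r) * Q with hQ'
    have hlin : (1 - C r⁻¹ * X : Polynomial Ω) * C (-r) = X - C r := by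
      rw [sub_mul, one_mul, mul_comm (C r⁻¹) X, mul_assoc, ← C_mul]
      rw [show r⁻¹ * -r = -1 by field_simp]
      simp [sub_eq_add_neg]
      ring
    have hUQ' : (1 - C r⁻¹ * X) * Q' = U := by
      rw [hQ', ← mul_assoc, hlin, hUQ]
    -- `Q'` has constant coefficient `1`, smaller degree, roots among those of `U`
    have hQ'0 : Q'.coeff 0 = 1 := by
      have h := congrArg (fun P : Polynomial Ω => P.coeff 0) hUQ'
      simp only [mul_coeff_zero] at h
      rw [hU0] at h
      have h1 : (1 - C r⁻¹ * X : Polynomial Ω).coeff 0 = 1 := by simp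
      rwa [h1, one_mul] at h
    have hQ'ne : Q' ≠ 0 := fun h => by rw [h, coeff_zero] at hQ'0; exact zero_ne_one hQ'0
    have hlin_ne : (1 - C r⁻¹ * X : Polynomial Ω) ≠ 0 := fun h => by
      rw [h, zero_mul] at hUQ'; exact hU0' hUQ'.symm
    have hlin_deg : (1 - C r⁻¹ * X : Polynomial Ω).natDegree = 1 := by
      have : (1 - C r⁻¹ * X : Polynomial Ω) = C (-r⁻¹) * X + C 1 := by
        simp [sub_eq_add_neg]; ring
      rw [this, natDegree_add_C, natDegree_C_mul_X _ (neg_ne_zero.mpr (inv_ne_zero hr0))]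
    have hQ'deg : Q'.natDegree ≤ n := by
      have h := congrArg natDegree hUQ'
      rw [natDegree_mul hlin_ne hQ'ne, hlin_deg] at h
      omega
    have hQ'roots : ∀ s : Ω, Q'.IsRoot s → 1 < V.valuation s := fun s hs =>
      hroots s (by rw [← hUQ']; exact hs.dvd (dvd_mul_left Q' _))
    have ihQ' := ih Q' hQ'deg hQ'0 hQ'roots
    obtain ⟨-, hprod⟩ := oneUnit_mul V (oneUnit_linear V hvr).1 (oneUnit_linear V hvr).2 hQ'0 ihQ'
    rw [← hUQ']
    exact hprod i hi

end OneUnit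

/-! ### Unit forms from root separation -/

section UnitForms

variable [IsAlgClosed Ω]

/-- **Unit forms from root separation.** Let `h` be a polynomial over the subfield
`m`, `a, c ∈ m`, `c ≠ 0`, and suppose every root `ρ` of `h` satisfies `|c| < |a − ρ|` (the closed
disc `|X − a| ≤ |c|` contains no root of `h`). Then `h(a) ≠ 0` and `h` has a UNIT FORM at the
centre `(a, c)`: `h(x) = h(a) · U((x − a)/c)` for every `x`, with `U` over `m`, `U(0) = 1` and
all higher coefficients of `U` of value `< 1` — `U(X′) = h(a + cX′)/h(a) = ∏ (1 + (c/(a − ρᵢ)) X′)`.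
(The format is that of `exists_unitForm`, `KaplanskyUnitForms.lean`, which produces unit forms
from Kaplansky's hypotheses on the approximation type instead.) [folklore] -/
theorem exists_unitForm_of_forall_isRoot (m : Subfield Ω) {a c : Ω} (ham : a ∈ m) (hcm : c ∈ m)
    (hc0 : c ≠ 0) {h : Polynomial Ω} (hhm : ∀ i, h.coeff i ∈ m)
    (hfar : ∀ ρ : Ω, h.IsRoot ρ → V.valuation c < V.valuation (a - ρ)) :
    h.eval a ≠ 0 ∧ ∃ U : Polynomial Ω, (∀ i, U.coeff i ∈ m) ∧ U.coeff 0 = 1 ∧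
      (∀ i, 1 ≤ i → V.valuation (U.coeff i) < 1) ∧
      ∀ x : Ω, h.eval x = h.eval a * U.eval ((x - a) / c) := by
  -- `h(a) ≠ 0`
  have hha : h.eval a ≠ 0 := fun h0 => by
    have := hfar a h0
    rw [sub_self, map_zero] at this
    exact not_lt_zero this
  refine ⟨hha, ?_⟩
  -- `U(X′) = h(a + c X′) / h(a)`
  set q : Polynomial Ω := C a + C c * X with hq
  set U : Polynomial Ω := C (h.eval a)⁻¹ * h.comp q with hU
  have hqm : ∀ i, q.coeff i ∈ m := by
    intro i
    rw [hq, coeff_add, coeff_C, coeff_C_mul, coeff_X]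
    refine m.add_mem ?_ (m.mul_mem hcm ?_) <;> split_ifs <;> simp [ham, m.one_mem, m.zero_mem]
  have hUm : ∀ i, U.coeff i ∈ m := by
    intro i
    rw [hU, coeff_C_mul]
    exact m.mul_mem (m.inv_mem (eval_mem_subfield_of_coeff_mem hhm ham))
      (ConjugateDiscs.coeff_comp_mem m.toSubring h q hhm hqm i)
  have hUeval : ∀ y : Ω, U.eval y = (h.eval a)⁻¹ * h.eval (a + c * y) := by
    intro y
    rw [hU, eval_mul, eval_C, eval_comp, hq, eval_add, eval_C, eval_mul, eval_C, eval_X]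
  have hU0 : U.coeff 0 = 1 := by
    rw [coeff_zero_eq_eval_zero, hUeval, mul_zero, add_zero, inv_mul_cancel₀ hha]
  -- the roots of `U` are the `(ρ − a)/c`, of value `> 1`
  have hUroots : ∀ r : Ω, U.IsRoot r → 1 < V.valuation r := by
    intro r hr
    rw [IsRoot.def, hUeval, mul_eq_zero] at hr
    rcases hr with hr | hr
    · exact absurd hr (inv_ne_zero hha)
    · have h1 := hfar (a + c * r) hr
      rw [sub_add_cancel_left, Valuation.map_neg, map_mul] at h1
      have hvc : V.valuation c ≠ 0 := (_root_.map_ne_zero _).mpr hc0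
      calc (1 : V.ValueGroup) = V.valuation c * (V.valuation c)⁻¹ := (mul_inv_cancel₀ hvc).symm
        _ < V.valuation c * V.valuation r * (V.valuation c)⁻¹ :=
            mul_lt_mul_of_pos_right h1 (inv_pos.mpr (zero_lt_iff.mpr hvc))
        _ = V.valuation r := by rw [mul_comm (V.valuation c), mul_assoc, mul_inv_cancel₀ hvc, mul_one]
  refine ⟨U, hUm, hU0, oneUnit_of_forall_isRoot V U.natDegree U le_rfl hU0 hUroots, fun x => ?_⟩
  rw [hUeval, ← mul_assoc, mul_inv_cancel₀ hha, one_mul, mul_div_cancel₀ _ hc0, add_sub_cancel]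

omit [IsAlgClosed Ω] in
/-- The root-separation hypothesis from a separation at the point: if `|x − a| ≤ |c| < |x − ρ|`
then `|c| < |a − ρ|` (and `|a − ρ| = |x − ρ|`). [folklore] -/
theorem valuation_lt_sub_of_valuation_sub_le {x a c ρ : Ω}
    (hxa : V.valuation (x - a) ≤ V.valuation c) (hρ : V.valuation c < V.valuation (x - ρ)) :
    V.valuation c < V.valuation (a - ρ) ∧ V.valuation (a - ρ) = V.valuation (x - ρ) := by
  have hlt : V.valuation (x - a) < V.valuation (x - ρ) := lt_of_le_of_lt hxa hρ
  have heq : V.valuation (a - ρ) = V.valuation (x - ρ) := by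
    have : a - ρ = (x - ρ) - (x - a) := by ring
    rw [this, Valuation.map_sub_eq_of_lt_left _ hlt]
  exact ⟨heq ▸ hρ, heq⟩

end UnitForms


/-! ### Strict comparison of multiset products in the value group -/

section Products

omit V in
/-- Termwise `≤` with one strict inequality and non-zero dominating terms gives a strict
inequality of products (in a linearly ordered commutative group with zero). [folklore] -/
theorem multiset_prod_map_lt {ι Γ₀ : Type*} [LinearOrderedCommGroupWithZero Γ₀]
    (s : Multiset ι) (f g : ι → Γ₀) (hle : ∀ i ∈ s, f i ≤ g i) (hg : ∀ i ∈ s, g i ≠ 0)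
    (hlt : ∃ i ∈ s, f i < g i) : (s.map f).prod < (s.map g).prod := by
  induction s using Multiset.induction_on with
  | empty => obtain ⟨i, hi, -⟩ := hlt; exact absurd hi (Multiset.notMem_zero i)
  | cons a s ih =>
    rw [Multiset.map_cons, Multiset.map_cons, Multiset.prod_cons, Multiset.prod_cons]
    have hle' : ∀ i ∈ s, f i ≤ g i := fun i hi => hle i (Multiset.mem_cons_of_mem hi)
    have hg' : ∀ i ∈ s, g i ≠ 0 := fun i hi => hg i (Multiset.mem_cons_of_mem hi)
    have hPle : (s.map f).prod ≤ (s.map g).prod := Multiset.prod_map_le_prod_map f g hle'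
    have hPg : (s.map g).prod ≠ 0 := by
      rw [Ne, Multiset.prod_eq_zero_iff, Multiset.mem_map]
      rintro ⟨i, hi, h0⟩
      exact hg' i hi h0
    have hga : g a ≠ 0 := hg a (Multiset.mem_cons_self a s)
    by_cases hfa : f a < g a
    · calc f a * (s.map f).prod ≤ f a * (s.map g).prod := mul_le_mul_right hPle _
        _ < g a * (s.map g).prod := mul_lt_mul_of_pos_right hfa (zero_lt_iff.mpr hPg)
    · have hfa' : f a = g a := le_antisymm (hle a (Multiset.mem_cons_self a s)) (not_lt.mp hfa)
      have hlt' : ∃ i ∈ s, f i < g i := by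
        obtain ⟨i, hi, hfi⟩ := hlt
        rcases Multiset.mem_cons.mp hi with rfl | hi
        · exact absurd hfi hfa
        · exact ⟨i, hi, hfi⟩
      calc f a * (s.map f).prod < f a * (s.map g).prod :=
            mul_lt_mul_of_pos_left (ih hle' hg' hlt') (zero_lt_iff.mpr (hfa' ▸ hga))
        _ = g a * (s.map g).prod := by rw [hfa']

end Products

/-! ### Deep centres for an element of transcendental immediate approximation type -/

section DeepCentres

variable [IsAlgClosed Ω] (K : Subfield Ω)

omit [IsAlgClosed Ω] in
/-- A polynomial form of algebraicity over a subfield. [folklore] -/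
theorem exists_polynomial_of_isAlgebraic {ρ : Ω} (hρ : IsAlgebraic K ρ) :
    ∃ G : Polynomial Ω, G ≠ 0 ∧ (∀ i, G.coeff i ∈ K) ∧ G.eval ρ = 0 := by
  obtain ⟨P, hP0, hPρ⟩ := hρ
  refine ⟨P.map (algebraMap K Ω), Polynomial.map_ne_zero hP0, fun i => ?_, ?_⟩
  · rw [coeff_map]; exact (P.coeff i).2
  · rwa [eval_map, ← aeval_def]

/-- **Algebraic elements do not approximate `x` as well as `K` does.** Let `x ∉ K` with
`(K(x)|K, V)` immediate (`hval`, `hres`) and of transcendental approximation type (`h3`,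
Kaplansky's condition: the values `|g(a)|` of every polynomial `g` over `K` are constant at all
`a ∈ K` deep enough). Then for every `ρ` algebraic over `K` there is `a ∈ K` with
`|x − a| < |x − ρ|`. (Otherwise `ρ` is a pseudo-limit of the approximants of `x` from `K`, and
for a polynomial `G` over `K` vanishing at `ρ` the values `|G(a)| = |lc| ∏ |a − ρⱼ|` strictly
decrease between two deep enough approximants — the factor of `ρ` does, the others do not
increase — contradicting `h3`.) [folklore] -/
theorem exists_mem_valuation_sub_lt_of_isAlgebraic {x : Ω} (hxK : x ∉ K)
    (hval : ∀ w ∈ Subfield.closure ((K : Set Ω) ∪ {x}), w ≠ 0 → ∃ b ∈ K,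
      V.valuation w = V.valuation b)
    (hres : ∀ w ∈ Subfield.closure ((K : Set Ω) ∪ {x}), w ∈ V → ∃ c ∈ K,
      V.valuation (w - c) < 1)
    (h3 : ∀ g : Polynomial Ω, (∀ k, g.coeff k ∈ K) → ∃ a₀ ∈ K, ∃ α : V.ValueGroup,
      ∀ a ∈ K, V.valuation (x - a) ≤ V.valuation (x - a₀) → V.valuation (g.eval a) = α)
    {ρ : Ω} (hρ : IsAlgebraic K ρ) :
    ∃ a ∈ K, V.valuation (x - a) < V.valuation (x - ρ) := by
  classical
  by_contra hcon
  push Not at hcon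
  -- `hcon : ∀ a ∈ K, |x − ρ| ≤ |x − a|`
  obtain ⟨G, hG0, hGK, hGρ⟩ := exists_polynomial_of_isAlgebraic K hρ
  have hsplit : G.Splits := IsAlgClosed.splits G
  obtain ⟨a₀, ha₀K, α, Hα⟩ := h3 G hGK
  -- approximants beating the "good" roots
  have hgood : ∀ r : Ω, ∃ b ∈ K, (∃ a ∈ K, V.valuation (x - a) < V.valuation (x - r)) →
      V.valuation (x - b) < V.valuation (x - r) := by
    intro r
    by_cases h : ∃ a ∈ K, V.valuation (x - a) < V.valuation (x - r)
    · obtain ⟨a, haK, ha⟩ := h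
      exact ⟨a, haK, fun _ => ha⟩
    · exact ⟨a₀, ha₀K, fun h' => absurd h' h⟩
  choose b hbK hb using hgood
  -- one element of `K` at least as deep as `a₀` and all the `b r`, `r` a root of `G`
  have hdeep : ∃ a₁ ∈ K, V.valuation (x - a₁) ≤ V.valuation (x - a₀) ∧
      ∀ r ∈ G.roots, V.valuation (x - a₁) ≤ V.valuation (x - b r) := by
    set T : Finset Ω := insert a₀ (G.roots.toFinset.image b) with hT
    have hTne : T.Nonempty := ⟨a₀, Finset.mem_insert_self _ _⟩
    obtain ⟨a₁, ha₁T, hmin⟩ := T.exists_min_image (fun a => V.valuation (x - a)) hTne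
    have ha₁K : a₁ ∈ K := by
      rcases Finset.mem_insert.mp ha₁T with rfl | h
      · exact ha₀K
      · obtain ⟨r, -, rfl⟩ := Finset.mem_image.mp h
        exact hbK r
    refine ⟨a₁, ha₁K, hmin a₀ (Finset.mem_insert_self _ _), fun r hr => hmin _ ?_⟩
    exact Finset.mem_insert_of_mem (Finset.mem_image_of_mem b (Multiset.mem_toFinset.mpr hr))
  obtain ⟨a₁, ha₁K, ha₁₀, ha₁b⟩ := hdeep
  -- two strictly deeper approximants
  obtain ⟨a₂, ha₂K, h₂₁⟩ := exists_valuation_sub_lt V K hxK hval hres ha₁K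
  obtain ⟨a₃, ha₃K, h₃₂⟩ := exists_valuation_sub_lt V K hxK hval hres ha₂K
  -- the values of `G` at `a₂`, `a₃` coincide by `h3`
  have hα₂ : V.valuation (G.eval a₂) = α := Hα a₂ ha₂K (h₂₁.le.trans ha₁₀)
  have hα₃ : V.valuation (G.eval a₃) = α := Hα a₃ ha₃K ((h₃₂.le.trans h₂₁.le).trans ha₁₀)
  -- but the product over the roots strictly decreases from `a₂` to `a₃`
  have hfac : ∀ a : Ω, V.valuation (G.eval a) =
      V.valuation G.leadingCoeff * (G.roots.map fun r => V.valuation (a - r)).prod := by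
    intro a
    rw [hsplit.eval_eq_prod_roots, map_mul, map_multiset_prod, Multiset.map_map]
    rfl
  have hlc : V.valuation G.leadingCoeff ≠ 0 :=
    (_root_.map_ne_zero _).mpr (leadingCoeff_ne_zero.mpr hG0)
  -- termwise comparison
  have hterm : ∀ r ∈ G.roots, V.valuation (a₃ - r) ≤ V.valuation (a₂ - r) ∧
      V.valuation (a₂ - r) ≠ 0 := by
    intro r hr
    by_cases hgr : ∃ a ∈ K, V.valuation (x - a) < V.valuation (x - r)
    · -- good root: both factors equal `|x − r|`
      have hbr := hb r hgr
      have h₂ : V.valuation (x - a₂) < V.valuation (x - r) :=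
        lt_of_lt_of_le h₂₁ ((ha₁b r hr).trans hbr.le)
      have h₃ : V.valuation (x - a₃) < V.valuation (x - r) := lt_trans h₃₂ h₂
      have e₂ : V.valuation (a₂ - r) = V.valuation (x - r) := by
        rw [show a₂ - r = (x - r) - (x - a₂) by ring, Valuation.map_sub_eq_of_lt_left _ h₂]
      have e₃ : V.valuation (a₃ - r) = V.valuation (x - r) := by
        rw [show a₃ - r = (x - r) - (x - a₃) by ring, Valuation.map_sub_eq_of_lt_left _ h₃]
      refine ⟨by rw [e₂, e₃], ?_⟩
      rw [e₂]
      exact ne_of_gt (lt_of_le_of_lt zero_le h₂)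
    · -- bad root: `|x − r| ≤ |x − a|` for all `a ∈ K`
      push Not at hgr
      have h₃ : V.valuation (x - r) ≤ V.valuation (x - a₃) := hgr a₃ ha₃K
      have e₂ : V.valuation (a₂ - r) = V.valuation (x - a₂) := by
        rw [show a₂ - r = (x - r) - (x - a₂) by ring, Valuation.map_sub_swap,
          Valuation.map_sub_eq_of_lt_left _ (lt_of_le_of_lt h₃ h₃₂)]
      have e₃ : V.valuation (a₃ - r) ≤ V.valuation (x - a₃) := by
        rw [show a₃ - r = (x - r) - (x - a₃) by ring]
        exact (Valuation.map_sub _ _ _).trans (max_le h₃ le_rfl)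
      refine ⟨e₃.trans (e₂ ▸ h₃₂.le), ?_⟩
      rw [e₂]
      exact ne_of_gt (lt_of_le_of_lt zero_le h₃₂)
  -- the root `ρ` is bad and gives a strict inequality
  have hρroot : ρ ∈ G.roots := (mem_roots hG0).mpr hGρ
  have hstrict : V.valuation (a₃ - ρ) < V.valuation (a₂ - ρ) := by
    have h₃ : V.valuation (x - ρ) ≤ V.valuation (x - a₃) := hcon a₃ ha₃K
    have e₂ : V.valuation (a₂ - ρ) = V.valuation (x - a₂) := by
      rw [show a₂ - ρ = (x - ρ) - (x - a₂) by ring, Valuation.map_sub_swap,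
        Valuation.map_sub_eq_of_lt_left _ (lt_of_le_of_lt h₃ h₃₂)]
    have e₃ : V.valuation (a₃ - ρ) ≤ V.valuation (x - a₃) := by
      rw [show a₃ - ρ = (x - ρ) - (x - a₃) by ring]
      exact (Valuation.map_sub _ _ _).trans (max_le h₃ le_rfl)
    rw [e₂]
    exact lt_of_le_of_lt e₃ h₃₂
  have hprod : (G.roots.map fun r => V.valuation (a₃ - r)).prod <
      (G.roots.map fun r => V.valuation (a₂ - r)).prod :=
    multiset_prod_map_lt G.roots _ _ (fun r hr => (hterm r hr).1) (fun r hr => (hterm r hr).2)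
      ⟨ρ, hρroot, hstrict⟩
  have hlt : V.valuation (G.eval a₃) < V.valuation (G.eval a₂) := by
    rw [hfac, hfac]
    exact mul_lt_mul_of_pos_left hprod (zero_lt_iff.mpr hlc)
  rw [hα₂, hα₃] at hlt
  exact lt_irrefl _ hlt

/-- **Deep centres.** In the situation of `exists_mem_valuation_sub_lt_of_isAlgebraic`, for
every finite set `R` of elements algebraic over `K` and every `a₀ ∈ K` there are `a, c ∈ K`,
`c ≠ 0`, with `|x − a| = |c| < |x − a₀|` and `|c| < |x − ρ|`, `|c| < |a − ρ| = |x − ρ|` for all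
`ρ ∈ R`: a `K`-rational disc `|X − a| ≤ |c|` through `x`, as deep as we please, containing no
element of `R` (the root-separation hypothesis of `exists_unitForm_of_forall_isRoot` for
polynomials with roots in `R`). [folklore] -/
theorem exists_deep_centre {x : Ω} (hxK : x ∉ K)
    (hval : ∀ w ∈ Subfield.closure ((K : Set Ω) ∪ {x}), w ≠ 0 → ∃ b ∈ K,
      V.valuation w = V.valuation b)
    (hres : ∀ w ∈ Subfield.closure ((K : Set Ω) ∪ {x}), w ∈ V → ∃ c ∈ K,
      V.valuation (w - c) < 1)
    (h3 : ∀ g : Polynomial Ω, (∀ k, g.coeff k ∈ K) → ∃ a₀ ∈ K, ∃ α : V.ValueGroup,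
      ∀ a ∈ K, V.valuation (x - a) ≤ V.valuation (x - a₀) → V.valuation (g.eval a) = α)
    (R : Finset Ω) (hR : ∀ ρ ∈ R, IsAlgebraic K ρ) {a₀ : Ω} (ha₀ : a₀ ∈ K) :
    ∃ a ∈ K, ∃ c ∈ K, c ≠ 0 ∧ V.valuation (x - a) = V.valuation c ∧
      V.valuation c < V.valuation (x - a₀) ∧
      ∀ ρ ∈ R, V.valuation c < V.valuation (x - ρ) ∧ V.valuation c < V.valuation (a - ρ) ∧
        V.valuation (a - ρ) = V.valuation (x - ρ) := by
  classical
  have hKx : ∀ c ∈ K, c ∈ Subfield.closure ((K : Set Ω) ∪ {x}) := fun c hc =>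
    Subfield.subset_closure (Or.inl hc)
  have hxx : x ∈ Subfield.closure ((K : Set Ω) ∪ {x}) := Subfield.subset_closure (Or.inr rfl)
  -- an approximant beating `a₀` and every element of `R`
  have key : ∃ a ∈ K, V.valuation (x - a) < V.valuation (x - a₀) ∧
      ∀ ρ ∈ R, V.valuation (x - a) < V.valuation (x - ρ) := by
    induction R using Finset.induction_on with
    | empty =>
      obtain ⟨a, haK, ha⟩ := exists_valuation_sub_lt V K hxK hval hres ha₀
      exact ⟨a, haK, ha, fun ρ hρ => absurd hρ (Finset.notMem_empty ρ)⟩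
    | insert ρ R hρR ih =>
      obtain ⟨a, haK, ha, hall⟩ := ih fun r hr => hR r (Finset.mem_insert_of_mem hr)
      obtain ⟨a', ha'K, ha'⟩ :=
        exists_mem_valuation_sub_lt_of_isAlgebraic V K hxK hval hres h3 (hR ρ (Finset.mem_insert_self ρ R))
      rcases le_total (V.valuation (x - a)) (V.valuation (x - a')) with h | h
      · refine ⟨a, haK, ha, fun r hr => ?_⟩
        rcases Finset.mem_insert.mp hr with rfl | hr
        · exact lt_of_le_of_lt h ha'
        · exact hall r hr
      · refine ⟨a', ha'K, lt_of_le_of_lt h ha, fun r hr => ?_⟩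
        rcases Finset.mem_insert.mp hr with rfl | hr
        · exact ha'
        · exact lt_of_le_of_lt h (hall r hr)
  obtain ⟨a, haK, ha, hall⟩ := key
  -- `|x − a|` is the value of a constant
  have hxa0 : x - a ≠ 0 := fun h => hxK (by rw [sub_eq_zero.mp h]; exact haK)
  obtain ⟨c, hcK, hc⟩ := hval (x - a) (sub_mem hxx (hKx a haK)) hxa0
  have hc0 : c ≠ 0 := by
    rintro rfl
    rw [map_zero, map_eq_zero] at hc
    exact hxa0 hc
  refine ⟨a, haK, c, hcK, hc0, hc, hc ▸ ha, fun ρ hρ => ?_⟩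
  have h1 : V.valuation c < V.valuation (x - ρ) := hc ▸ hall ρ hρ
  have heq : V.valuation (a - ρ) = V.valuation (x - ρ) := by
    rw [show a - ρ = (x - ρ) - (x - a) by ring, Valuation.map_sub_eq_of_lt_left _ (hc ▸ h1)]
  exact ⟨h1, heq ▸ h1, heq⟩

end DeepCentres


/-! ### Separable elements over a finite level of the perfect hull -/

section Separable

/-- **Separability over a finite level of the perfect hull**: an element algebraic over `k` is
separable over `k(r)` for some finite `r ⊆ k^{1/p^∞}` (the coefficients of its minimal
polynomial over the perfect field `k^{1/p^∞}`), and then over `k(r')` for every finite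
`r' ⊇ r` inside `k^{1/p^∞}`. [folklore] -/
theorem exists_finset_isSeparable_closure [PerfectField Ω] {k : Subfield Ω} {y : Ω}
    (hy : IsAlgebraic k y) :
    ∃ r : Finset Ω, (↑r : Set Ω) ⊆ perfectHull k ∧
      ∀ r' : Finset Ω, (↑r : Set Ω) ⊆ ↑r' → (↑r' : Set Ω) ⊆ perfectHull k →
        IsSeparable (Subfield.closure ((k : Set Ω) ∪ ↑r')) y := by
  classical
  set k' : Subfield Ω := perfectHull k with hk'
  have hkk' : k ≤ k' := le_perfectHull k
  have hyk' : IsAlgebraic k' y := isAlgebraic_of_subfield_le hkk' hy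
  have hint : IsIntegral k' y := hyk'.isIntegral
  set Q : Polynomial k' := minpoly k' y with hQ
  have hQsep : Q.Separable := PerfectField.separable_of_irreducible (minpoly.irreducible hint)
  -- the coefficients of `Q`
  set r : Finset Ω := (Q.support).image fun j => ((Q.coeff j : k') : Ω) with hrdef
  have hr : (↑r : Set Ω) ⊆ k' := by
    intro c hc
    obtain ⟨j, -, rfl⟩ := Finset.mem_image.mp (Finset.mem_coe.mp hc)
    exact (Q.coeff j).2
  refine ⟨r, hr, fun r' hrr' hr' => ?_⟩
  set K₀ : Subfield Ω := Subfield.closure ((k : Set Ω) ∪ ↑r') with hK₀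
  have hcoef : ∀ j, ((Q.coeff j : k') : Ω) ∈ K₀ := by
    intro j
    by_cases hj : j ∈ Q.support
    · exact Subfield.subset_closure (Or.inr (hrr' (Finset.mem_image_of_mem _ hj)))
    · rw [Polynomial.notMem_support_iff.mp hj]; exact K₀.zero_mem
  -- `Q` descends to `K₀`
  set QΩ : Polynomial Ω := Q.map (algebraMap k' Ω) with hQΩ
  obtain ⟨Q₀, hQ₀⟩ : ∃ Q₀ : Polynomial K₀, Q₀.map (algebraMap K₀ Ω) = QΩ :=
    (Polynomial.mem_lifts QΩ).mp ((Polynomial.lifts_iff_coeff_lifts QΩ).mpr fun j =>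
      ⟨⟨QΩ.coeff j, by rw [hQΩ, Polynomial.coeff_map]; exact hcoef j⟩, rfl⟩)
  have hQ₀y : aeval y Q₀ = 0 := by
    rw [Polynomial.aeval_def, ← Polynomial.eval_map, hQ₀, hQΩ, Polynomial.eval_map, ← Polynomial.aeval_def, hQ]
    exact minpoly.aeval k' y
  have hQ₀sep : Q₀.Separable := by
    rw [← Polynomial.separable_map (algebraMap K₀ Ω), hQ₀, hQΩ, Polynomial.separable_map]
    exact hQsep
  exact (minpoly.dvd K₀ y hQ₀y).elim fun c hc => hQ₀sep.of_dvd ⟨c, hc⟩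

end Separable

/-! ### The perfect split base of a valuation-algebraic extension (characteristic `p`) -/

section SplitBase

variable [IsAlgClosed Ω]

/-- **The perfect split base.** Let `(Ω, V)` be algebraically closed of characteristic `p > 0`
(= residue characteristic), `k ≤ F ≤ Ω` with `k` of rank one, `|F^×|/|k^×|` torsion and
`F̃/k̃` algebraic. Put `E = (F·k^{1/p^∞})^h` and `C = E ∩ k̃` (the elements of `E` algebraic
over `k`). Then `C` is perfect, henselian, of rank one, algebraically closed in `E`, and
`(E|C, V)` is IMMEDIATE (`RelAlgClosedImmediate.lean`). This is Step 2 of the proof of Temkin's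
Thm. 3.2.3 ("`L ⊂ K` the completion of `K ∩ k^a` … `K` is `L`-split") after the perfect base
change of Thm. 3.2.6, Step 2, read in henselizations; it is the base over which the valuative
input of Thm. 3.3.1 is produced (`HenselianRationalityPerfect.lean`,
`RelativeCurveValuativeInputCharP.lean`) and over which the generator has transcendental
immediate approximation type (`kaplansky_of_split`, below).
[cite: Temkin2013, Thm. 3.2.3 (proof, Step 2) and Thm. 3.2.6 (proof, Step 2)] -/
theorem exists_perfect_split_base (p : ℕ) [hp : Fact p.Prime] [CharP Ω p]
    [CharP (ResidueField V) p] {k F : Subfield Ω} (hkF : k ≤ F) (hr1 : IsRankOneValued V k)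
    (htors : IsValueTorsionOver V k F) (hres : IsResiduallyAlgebraicOver V k F) :
    ∃ C E : Subfield Ω, k ≤ C ∧ C ≤ E ∧ F ≤ E ∧ perfectHull k ≤ C ∧
      E = henselization V (Subfield.closure ((F : Set Ω) ∪ perfectHull k)) ∧
      (∀ a ∈ C, IsAlgebraic k a) ∧ (∀ a ∈ E, IsAlgebraic k a → a ∈ C) ∧
      (∀ a ∈ E, IsAlgebraic C a → a ∈ C) ∧ (∀ y ∈ C, ∃ b ∈ C, b ^ p = y) ∧
      IsHenselianField C (V.comap (algebraMap C Ω)) ∧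
      IsHenselianField E (V.comap (algebraMap E Ω)) ∧
      IsRankOneValued V C ∧ IsImmediateOver V C E := by
  classical
  haveI : ExpChar Ω p := ExpChar.prime hp.out
  have hhens := Kuhlmann2010HenselizationIsHenselian_holds.{u}
  set k' : Subfield Ω := perfectHull k with hk'def
  have hkk' : k ≤ k' := le_perfectHull k
  haveI : PerfectField k' := perfectField_perfectHull k
  have hk'alg : ∀ a ∈ k', IsAlgebraic k a := fun a ha => isAlgebraic_of_mem_perfectHull k ha
  set F' : Subfield Ω := Subfield.closure ((F : Set Ω) ∪ k') with hF'def
  have hFF' : F ≤ F' := fun a ha => Subfield.subset_closure (Or.inl ha)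
  have hk'F' : k' ≤ F' := fun a ha => Subfield.subset_closure (Or.inr ha)
  set E : Subfield Ω := henselization V F' with hEdef
  have hF'E : F' ≤ E := le_henselization V F'
  have hFE : F ≤ E := hFF'.trans hF'E
  have hE : IsHenselianField E (V.comap (algebraMap E Ω)) := hhens Ω V F'
  set Ca : Subfield Ω := (algebraicClosure k Ω).toSubfield with hCadef
  have hCa : ∀ a : Ω, a ∈ Ca ↔ IsAlgebraic k a := fun a => mem_algebraicClosure_iff
  set C : Subfield Ω := E ⊓ Ca with hCdef
  have hCE : C ≤ E := inf_le_left
  have hCalg : ∀ a ∈ C, IsAlgebraic k a := fun a ha => (hCa a).mp (Subfield.mem_inf.mp ha).2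
  have hk'C : k' ≤ C := fun a ha => Subfield.mem_inf.mpr ⟨hF'E (hk'F' ha), (hCa a).mpr (hk'alg a ha)⟩
  have hkC : k ≤ C := hkk'.trans hk'C
  have hrelk : ∀ a ∈ E, IsAlgebraic k a → a ∈ C := fun a haE ha =>
    Subfield.mem_inf.mpr ⟨haE, (hCa a).mpr ha⟩
  have hrel : ∀ a ∈ E, IsAlgebraic C a → a ∈ C := fun a haE ha =>
    hrelk a haE (isAlgebraic_trans_subfield hkC hCalg ha)
  -- `C` is perfect
  have hperfC : ∀ y ∈ C, ∃ b ∈ C, b ^ p = y := by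
    intro y hy
    obtain ⟨b, hb⟩ := IsAlgClosed.exists_pow_nat_eq y hp.out.pos
    have hbalg : IsAlgebraic k b := IsAlgebraic.of_pow hp.out.pos (by rw [hb]; exact hCalg y hy)
    have hbsep : IsSeparable k' b := PerfectField.separable_of_irreducible
      (minpoly.irreducible (isAlgebraic_of_subfield_le hkk' hbalg).isIntegral)
    have hbE : b ∈ E := mem_of_isSeparable_of_pow_mem E p
      (isSeparable_of_subfield_le (hk'F'.trans hF'E) hbsep) (by rw [hb]; exact hCE hy)
    exact ⟨b, Subfield.mem_inf.mpr ⟨hbE, (hCa b).mpr hbalg⟩, hb⟩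
  haveI : PerfectField C := perfectField_of_forall_exists_pow_eq p hperfC
  -- `C` is henselian (algebraic over `(k')^h ≤ C`)
  have hH₀E : henselization V k' ≤ E := henselization_mono V hhens hk'F'
  have hH₀Ca : henselization V k' ≤ Ca := fun a ha => (hCa a).mpr
    (isAlgebraic_trans_subfield hkk' hk'alg (isSeparable_of_mem_henselization V k' ha).isIntegral.isAlgebraic)
  have hH₀C : henselization V k' ≤ C := le_inf hH₀E hH₀Ca
  have hC : IsHenselianField C (V.comap (algebraMap C Ω)) :=
    IsHenselianField.of_subfield_algebraic V hH₀C
      (fun a ha => isAlgebraic_of_subfield_le (hkk'.trans (le_henselization V k')) (hCalg a ha))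
      (hhens Ω V k')
  -- rank one
  have hr1C : IsRankOneValued V C := IsRankOneValued.of_algebraic V hkC hr1 hCalg
  -- `(E|C)` is immediate
  have hF'alg : ∀ a ∈ F', IsAlgebraic F a := fun a ha =>
    isAlgebraic_of_mem_closure (fun x hx => isAlgebraic_of_subfield_le hkF (hk'alg x hx)) ha
  have htorsF' : IsValueTorsionOver V k F' := htors.trans (isValueTorsionOver_of_isAlgebraic V hF'alg)
  have himmE' : IsImmediateOver V F' E := Kuhlmann2010HenselizationImmediate_holds Ω V F'
  have htorsE : ∀ a ∈ E, a ≠ 0 → ∃ n : ℕ, n ≠ 0 ∧ ∃ b ∈ C, V.valuation (a ^ n) = V.valuation b := by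
    intro a ha ha0
    obtain ⟨a', ha'F', haa'⟩ := himmE'.1 a ha ha0
    have ha'0 : a' ≠ 0 := by rintro rfl; rw [map_zero, map_eq_zero] at haa'; exact ha0 haa'
    obtain ⟨n, hn, b, hbk, hb⟩ := htorsF' a' ha'F' ha'0
    exact ⟨n, hn, b, hkC hbk, by rw [map_pow, haa', ← map_pow, hb]⟩
  have hresE : ∀ (r : Ω) (hrE : r ∈ E) (hrV : r ∈ V), IsAlgebraic (resField V C) (residue V ⟨r, hrV⟩) := by
    intro r hrE hrV
    have hr1' : residue V ⟨r, hrV⟩ ∈ resField V F' := himmE'.2 (residue_mem_resField V ⟨r, hrV⟩ hrE)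
    have hr2 : IsAlgebraic (resField V F) (residue V ⟨r, hrV⟩) :=
      isResiduallyAlgebraicOver_of_isAlgebraic V hF'alg _ hr1'
    have hr3 : IsAlgebraic (resField V k) (residue V ⟨r, hrV⟩) :=
      isAlgebraic_trans_subfield (resField_mono V hkF) hres hr2
    exact isAlgebraic_of_subfield_le (resField_mono V hkC) hr3
  have himm : IsImmediateOver V C E :=
    isImmediateOver_of_forall_isAlgebraic_mem V p hCE hperfC hE hrel htorsE hresE
  exact ⟨C, E, hkC, hCE, hFE, hk'C, rfl, hCalg, hrelk, hrel, hperfC, hC, hE, hr1C, himm⟩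

/-- **The generator has transcendental immediate approximation type over the perfect split
base.** In the situation of `exists_perfect_split_base`, every `x ∈ E` transcendental over `k`
satisfies Kaplansky's hypotheses over `C` in the form consumed by `exists_unitForm`,
`exists_approximationDegree`, `exists_deep_centre`, …: `x ∉ C`, `(C(x)|C, V)` immediate
(`hval`, `hres`), of rank one, and of transcendental approximation type (`h3`). (`E` is
`C`-split: Temkin 2013, Cor. 3.1.10, tree `kaplansky_of_split`.)
[cite: Temkin2013, Cor. 3.1.10 with Thm. 3.2.3 (proof, Step 2)] -/
theorem kaplansky_of_perfect_split_base (p : ℕ) [hp : Fact p.Prime] [CharP Ω p]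
    [CharP (ResidueField V) p] {k C E : Subfield Ω} (hkC : k ≤ C) (hCE : C ≤ E)
    (hCalg : ∀ a ∈ C, IsAlgebraic k a) (hrel : ∀ a ∈ E, IsAlgebraic C a → a ∈ C)
    (hperfC : ∀ y ∈ C, ∃ b ∈ C, b ^ p = y) (hC : IsHenselianField C (V.comap (algebraMap C Ω)))
    (hE : IsHenselianField E (V.comap (algebraMap E Ω))) (hr1C : IsRankOneValued V C)
    (himm : IsImmediateOver V C E) {x : Ω} (hxE : x ∈ E) (hxt : Transcendental k x) :
    x ∉ C ∧
    (∀ w ∈ Subfield.closure ((C : Set Ω) ∪ {x}), w ≠ 0 → ∃ b ∈ C,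
      V.valuation w = V.valuation b) ∧
    (∀ w ∈ Subfield.closure ((C : Set Ω) ∪ {x}), w ∈ V → ∃ c ∈ C,
      V.valuation (w - c) < 1) ∧
    IsRankOneValued V (Subfield.closure ((C : Set Ω) ∪ {x})) ∧
    (∀ g : Polynomial Ω, (∀ i, g.coeff i ∈ C) → ∃ a₀ ∈ C, ∃ α : V.ValueGroup,
      ∀ a ∈ C, V.valuation (x - a) ≤ V.valuation (x - a₀) → V.valuation (g.eval a) = α) := by
  have hxtC : Transcendental C x := fun h => hxt (isAlgebraic_trans_subfield hkC hCalg h)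
  have hxC : x ∉ C := fun h => hxtC (isAlgebraic_algebraMap (⟨x, h⟩ : C))
  obtain ⟨-, himmx, hr1x, h3⟩ := kaplansky_of_split V p hCE hC hperfC hr1C hE hrel himm hxE hxtC
  exact ⟨hxC, himmx.1, hres_of_isImmediateOver V himmx, hr1x, h3⟩

/-- **Descent of finitely many split-base constants to a finite level.** In the situation of
`exists_perfect_split_base`, finitely many elements of `C` lie in the henselization of one
finite purely inseparable level `F·k(r)`, `r` finite `⊆ k^{1/p^∞}`, and are separable over
`k(r)`: at that level they are legitimate SEPARABLE CONSTANTS IN THE HENSELIZATION (the format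
of the constants of the chart datum of Thm. 3.3.1). [folklore] -/
theorem exists_finset_level_of_subset_split_base {k F C E : Subfield Ω} (hCE : C ≤ E)
    (hE : E = henselization V (Subfield.closure ((F : Set Ω) ∪ perfectHull k)))
    (hCalg : ∀ a ∈ C, IsAlgebraic k a) (t : Finset Ω) (ht : (↑t : Set Ω) ⊆ C) :
    ∃ r : Finset Ω, (↑r : Set Ω) ⊆ perfectHull k ∧
      ∀ a ∈ t, a ∈ henselization V (Subfield.closure ((k : Set Ω) ∪ ↑r ∪ F)) ∧
        IsSeparable (Subfield.closure ((k : Set Ω) ∪ ↑r)) a := by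
  classical
  haveI : PerfectField Ω := IsAlgClosed.perfectField Ω
  have hkP : k ≤ perfectHull k := le_perfectHull k
  -- membership in the henselization of one level
  have ht' : ∀ z ∈ t, z ∈ henselization V (Subfield.closure ((perfectHull k : Set Ω) ∪ F)) := by
    intro z hz
    have := hCE (ht hz)
    rwa [hE, Set.union_comm] at this
  obtain ⟨r₁, hr₁P, hr₁⟩ := exists_finset_forall_mem_henselization_closure_levels V hkP (F : Set Ω) t ht'
  -- separability over one level, elementwise, monotone in the level
  have hsep : ∀ a : Ω, ∃ ra : Finset Ω, (↑ra : Set Ω) ⊆ perfectHull k ∧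
      (a ∈ t → ∀ r' : Finset Ω, (↑ra : Set Ω) ⊆ ↑r' → (↑r' : Set Ω) ⊆ perfectHull k →
        IsSeparable (Subfield.closure ((k : Set Ω) ∪ ↑r')) a) := by
    intro a
    by_cases ha : a ∈ t
    · obtain ⟨ra, hra, h⟩ := exists_finset_isSeparable_closure (hCalg a (ht ha))
      exact ⟨ra, hra, fun _ => h⟩
    · exact ⟨∅, by simp, fun h => absurd h ha⟩
  choose ra hraP hra using hsep
  set r : Finset Ω := r₁ ∪ t.biUnion ra with hrdef
  have hrP : (↑r : Set Ω) ⊆ perfectHull k := by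
    intro z hz
    rcases Finset.mem_union.mp (Finset.mem_coe.mp hz) with hz | hz
    · exact hr₁P hz
    · obtain ⟨a, -, hza⟩ := Finset.mem_biUnion.mp hz
      exact hraP a hza
  refine ⟨r, hrP, fun a ha => ⟨?_, ?_⟩⟩
  · refine henselization_mono V Kuhlmann2010HenselizationIsHenselian_holds.{u} ?_ (hr₁ a ha)
    refine Subfield.closure_mono (Set.union_subset_union_left _ (Set.union_subset_union_right _ ?_))
    exact fun z hz => Finset.mem_union_left _ hz
  · exact hra a ha r (fun z hz => Finset.mem_union_right _ (Finset.mem_biUnion.mpr ⟨a, ha, hz⟩)) hrP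

end SplitBase


/-! ### The assembly at a finite level (characteristic `p`) -/

section Assembly

variable [IsAlgClosed Ω]

/-- **Deep separable centres for the generator, at a finite purely inseparable level**
(characteristic `p`). Let `(Ω, V)` be algebraically closed of characteristic `p` = residue
characteristic, `k ≤ F ≤ Ω` with `k` of rank one, `|F^×|/|k^×|` torsion and `F̃/k̃` algebraic
(e.g. the level data of Thm. 3.3.1), `x ∈ F` transcendental over `k`, `R` a finite set of
elements algebraic over `k` (the roots of the finitely many denominators to be given unit
forms), `a₀ ∈ k`. Then there are a finite `r ⊆ k^{1/p^∞}` and constants `a, c` — algebraic over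
`k`, SEPARABLE over `k(r)`, lying in the henselization of `F·k(r)` — with `c ≠ 0`,
`|x − a| = |c| < |x − a₀|`, and `|c| < |x − ρ|`, `|c| < |a − ρ| = |x − ρ|` for every `ρ ∈ R`:
an `m`-rational disc through `x` avoiding `R`, for the constant field `m = k(r)(a, c)` of a
finite level, on which every polynomial with roots in `R` has a unit form
(`exists_unitForm_of_forall_isRoot`). [cite: Temkin2013, Thm. 3.2.6 (proof, Steps 1–2) with
Thm. 3.2.3 (proof, Step 2) and Lemma 3.2.7] -/
theorem exists_deep_separable_centre_charP (p : ℕ) [hp : Fact p.Prime] [CharP Ω p]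
    [CharP (ResidueField V) p] {k F : Subfield Ω} (hkF : k ≤ F) (hr1 : IsRankOneValued V k)
    (htors : IsValueTorsionOver V k F) (hres : IsResiduallyAlgebraicOver V k F)
    {x : Ω} (hxF : x ∈ F) (hxt : Transcendental k x)
    (R : Finset Ω) (hR : ∀ ρ ∈ R, IsAlgebraic k ρ) {a₀ : Ω} (ha₀ : a₀ ∈ k) :
    ∃ (r : Finset Ω) (a c : Ω), (↑r : Set Ω) ⊆ perfectHull k ∧
      IsAlgebraic k a ∧ IsAlgebraic k c ∧
      IsSeparable (Subfield.closure ((k : Set Ω) ∪ ↑r)) a ∧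
      IsSeparable (Subfield.closure ((k : Set Ω) ∪ ↑r)) c ∧
      a ∈ henselization V (Subfield.closure ((k : Set Ω) ∪ ↑r ∪ F)) ∧
      c ∈ henselization V (Subfield.closure ((k : Set Ω) ∪ ↑r ∪ F)) ∧
      c ≠ 0 ∧ V.valuation (x - a) = V.valuation c ∧ V.valuation c < V.valuation (x - a₀) ∧
      ∀ ρ ∈ R, V.valuation c < V.valuation (x - ρ) ∧ V.valuation c < V.valuation (a - ρ) ∧
        V.valuation (a - ρ) = V.valuation (x - ρ) := by
  classical
  obtain ⟨C, E, hkC, hCE, hFE, -, hEdef, hCalg, -, hrel, hperfC, hC, hE, hr1C, himm⟩ :=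
    exists_perfect_split_base V p hkF hr1 htors hres
  obtain ⟨hxC, hval, hres', -, h3⟩ :=
    kaplansky_of_perfect_split_base V p hkC hCE hCalg hrel hperfC hC hE hr1C himm (hFE hxF) hxt
  obtain ⟨a, haC, c, hcC, hc0, hxa, hdeep, hfar⟩ :=
    exists_deep_centre V C hxC hval hres' h3 R
      (fun ρ hρ => isAlgebraic_of_subfield_le hkC (hR ρ hρ)) (hkC ha₀)
  obtain ⟨r, hrP, hr⟩ := exists_finset_level_of_subset_split_base V hCE hEdef hCalg {a, c}
    (by
      intro z hz
      rcases Finset.mem_insert.mp (Finset.mem_coe.mp hz) with rfl | hz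
      · exact haC
      · rw [Finset.mem_singleton.mp hz]; exact hcC)
  obtain ⟨haH, hasep⟩ := hr a (Finset.mem_insert_self _ _)
  obtain ⟨hcH, hcsep⟩ := hr c (Finset.mem_insert_of_mem (Finset.mem_singleton_self _))
  exact ⟨r, a, c, hrP, hCalg a haC, hCalg c hcC, hasep, hcsep, haH, hcH, hc0, hxa, hdeep, hfar⟩

end Assembly


/-! ### Krasner-good centres: the induction on the degree -/

section KrasnerGood

variable [IsAlgClosed Ω]

variable (p : ℕ) [hp : Fact p.Prime] [CharP Ω p]

open IntermediateField in
/-- **Krasner-good approximants over a perfect henselian field of rank one** (the algebraic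
content of Temkin 2013, Cor. 3.1.9 "the disc `E(x, s)` is `l`-split for a finite extension `l/k`
for all radii `s` off a discrete set", with Lemma 3.1.3: `E_k(a, r)` is `k(a)`-split iff
`r < min_{i>1} |a − aᵢ|`). Let `K ≤ C ≤ Ω` with `K` perfect, henselian, of rank one and `C`
algebraic over `K`; let `x ∈ Ω`, `g ≠ 0` algebraic over `K`, and `a ∈ C` with `|x − a| < |g|`.
Then there is `a′ ∈ C` with `|x − a′| < |g|` which is KRASNER-GOOD for `x`: `|x − a′| < |a′ − ρ|`
for every root `ρ ≠ a′` of the minimal polynomial of `a′` over `K`. Induction on the degree of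
`a`: if some conjugate `ρ₁ ≠ a` has `|a − ρ₁| ≤ |x − a| =: γ`, the automorphisms `σ` of the
normal hull `M` of `K(a)` with `|σa − a| ≤ γ` form a subgroup `N ⊋ Gal(M|K(a))` (conjugation is
an isometry over the henselian `K`), whose fixed field `H ⊊ K(a)` is perfect, henselian, of rank
one, and over which all conjugates of `a` lie within `γ` of `a`; by Prop. 3.1.7 over `H`
(`exists_conj_krasnerRadius_eq_dist_of_isIntegral_of_perfect`: Krasner radius = distance) some
`c ∈ H` has `|a − c| < |g|`, so `|x − c| < |g|` with `c` of smaller degree.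
[cite: Temkin2013, Cor. 3.1.9 with Lemma 3.1.3 and Prop. 3.1.7] -/
theorem exists_krasnerGood_of_perfect [CharP (ResidueField V) p] {K C : Subfield Ω} (hKC : K ≤ C)
    (hK : IsHenselianField K (V.comap (algebraMap K Ω))) (hperf : ∀ y ∈ K, ∃ b ∈ K, b ^ p = y)
    (hr1 : IsRankOneValued V K) (hCalg : ∀ a ∈ C, IsAlgebraic K a)
    {x g : Ω} (hg : IsAlgebraic K g) :
    ∀ (n : ℕ) (a : Ω), a ∈ C → (minpoly K a).natDegree ≤ n →
      V.valuation (x - a) < V.valuation g →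
      ∃ a' ∈ C, V.valuation (x - a') < V.valuation g ∧
        ∀ ρ ∈ (minpoly K a').aroots Ω, ρ ≠ a' → V.valuation (x - a') < V.valuation (a' - ρ) := by
  classical
  haveI : ExpChar K p := ExpChar.prime hp.out
  haveI : PerfectRing K p := PerfectRing.ofSurjective K p fun y => by
    obtain ⟨b, hb, h⟩ := hperf y y.2
    exact ⟨⟨b, hb⟩, Subtype.ext (by simpa [frobenius] using h)⟩
  haveI : PerfectField K := PerfectRing.toPerfectField K p
  intro n
  induction n with
  | zero =>
    intro a haC hdeg _
    exact absurd hdeg (not_le.mpr (minpoly.natDegree_pos (hCalg a haC).isIntegral))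
  | succ n ih =>
    intro a haC hdeg hxa
    have haint : IsIntegral K a := (hCalg a haC).isIntegral
    by_cases hgood : ∀ ρ ∈ (minpoly K a).aroots Ω, ρ ≠ a → V.valuation (x - a) < V.valuation (a - ρ)
    · exact ⟨a, haC, hxa, hgood⟩
    push Not at hgood
    obtain ⟨ρ₁, hρ₁, hρ₁a, hρ₁le⟩ := hgood
    -- ### the normal hull `M` of `K(a)` inside `Ω`
    set f : K[X] := minpoly K a with hf
    have hfsep : f.Separable := PerfectField.separable_of_irreducible (minpoly.irreducible haint)
    have hsplits : (f.map (algebraMap K Ω)).Splits := IsAlgClosed.splits _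
    set M : IntermediateField K Ω := adjoin K (f.rootSet Ω) with hM
    haveI hsf : f.IsSplittingField K M := adjoin_rootSet_isSplittingField hsplits
    haveI : FiniteDimensional K M := Polynomial.IsSplittingField.finiteDimensional M f
    haveI : IsGalois K M := IsGalois.of_separable_splitting_field hfsep
    have hroot_mem : ∀ ρ ∈ f.aroots Ω, ρ ∈ M := fun ρ hρ => by
      refine subset_adjoin K (f.rootSet Ω) ?_
      rw [mem_rootSet]
      exact ⟨minpoly.ne_zero haint, (mem_aroots.mp hρ).2⟩
    have haM : a ∈ M := hroot_mem a (by
      rw [mem_aroots]; exact ⟨minpoly.ne_zero haint, minpoly.aeval K a⟩)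
    set aM : M := ⟨a, haM⟩ with haMdef
    have haMint : IsIntegral K aM := IsIntegral.of_finite K aM
    have hminaM : minpoly K aM = f := by
      rw [hf, show a = algebraMap M Ω aM from rfl]
      exact (minpoly.algebraMap_eq (algebraMap M Ω).injective aM).symm
    -- conjugation is an isometry (`K` henselian)
    have hiso : ∀ (σ : M ≃ₐ[K] M) (z : M), V.valuation ((σ z : M) : Ω) = V.valuation (z : Ω) :=
      fun σ z => hK.valuation_algHom_apply V ((IsScalarTower.toAlgHom K M Ω).comp (σ : M →ₐ[K] M)) z
    -- ### the subgroup `N` of automorphisms moving `a` by at most `γ = |x − a|`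
    set γ := V.valuation (x - a) with hγ
    let N : Subgroup (M ≃ₐ[K] M) :=
      { carrier := {σ | V.valuation (((σ aM : M) : Ω) - a) ≤ γ}
        one_mem' := by
          change V.valuation ((((1 : M ≃ₐ[K] M) aM : M) : Ω) - a) ≤ γ
          rw [AlgEquiv.one_apply, sub_self, map_zero]; exact zero_le
        mul_mem' := by
          intro σ τ hσ hτ
          change V.valuation ((((σ * τ) aM : M) : Ω) - a) ≤ γ
          have h1 : V.valuation (((σ (τ aM - aM) : M) : Ω)) ≤ γ := by
            rw [hiso]; push_cast; exact hτ
          have key : ((((σ * τ) aM : M)) : Ω) - a = ((σ (τ aM - aM) : M) : Ω) + ((((σ aM : M)) : Ω) - a) := by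
            rw [AlgEquiv.mul_apply, map_sub]; push_cast; ring
          rw [key]
          exact Valuation.map_add_le _ h1 hσ
        inv_mem' := by
          intro σ hσ
          change V.valuation ((((σ⁻¹) aM : M) : Ω) - a) ≤ γ
          have key : ((((σ⁻¹) aM : M)) : Ω) - a = -(((σ⁻¹ (σ aM - aM) : M)) : Ω) := by
            rw [map_sub, ← AlgEquiv.mul_apply, inv_mul_cancel, AlgEquiv.one_apply]
            push_cast; ring
          rw [key, Valuation.map_neg, hiso]
          push_cast
          exact hσ }
    have hmemN : ∀ σ : M ≃ₐ[K] M, σ ∈ N ↔ V.valuation (((σ aM : M) : Ω) - a) ≤ γ := fun σ => Iff.rfl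
    -- `N` contains the stabiliser of `a` and an automorphism `σ₁` with `σ₁ a = ρ₁ ≠ a`
    have hstab : K⟮aM⟯.fixingSubgroup ≤ N := by
      intro σ hσ
      rw [hmemN, (mem_fixingSubgroup_iff _ _).mp hσ aM (mem_adjoin_simple_self K aM), sub_self, map_zero]
      exact zero_le
    have hρ₁M : ρ₁ ∈ M := hroot_mem ρ₁ hρ₁
    set ρM : M := ⟨ρ₁, hρ₁M⟩ with hρMdef
    obtain ⟨σ₁, hσ₁⟩ : ∃ σ₁ : M ≃ₐ[K] M, σ₁ aM = ρM := by
      have hmin : minpoly K ρM = minpoly K aM := by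
        have h1 : minpoly K ρ₁ = f :=
          (minpoly.eq_of_irreducible_of_monic (minpoly.irreducible haint) (mem_aroots.mp hρ₁).2
            (minpoly.monic haint)).symm
        have h2 : minpoly K ρM = minpoly K ρ₁ :=
          (minpoly.algebraMap_eq (algebraMap M Ω).injective ρM).symm
        rw [h2, h1, hminaM]
      obtain ⟨σ₁, hσ₁⟩ := (Normal.minpoly_eq_iff_mem_orbit (F := K) (E := M)).mp hmin
      exact ⟨σ₁, hσ₁⟩
    have hσ₁N : σ₁ ∈ N := by
      rw [hmemN, hσ₁]
      change V.valuation (ρ₁ - a) ≤ γ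
      rw [Valuation.map_sub_swap]; exact hρ₁le
    have hσ₁notfix : σ₁ ∉ K⟮aM⟯.fixingSubgroup := fun h => by
      have := (mem_fixingSubgroup_iff _ _).mp h aM (mem_adjoin_simple_self K aM)
      rw [hσ₁] at this
      exact hρ₁a (congrArg Subtype.val this)
    -- ### the fixed field `H` of `N`: `H < K(a)`
    set H : IntermediateField K M := fixedField N with hHdef
    have hHle : H ≤ K⟮aM⟯ := by
      rw [hHdef, ← IsGalois.fixedField_fixingSubgroup K⟮aM⟯]
      exact fixedField_le hstab
    have hHne : H ≠ K⟮aM⟯ := fun heq => by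
      have : N = K⟮aM⟯.fixingSubgroup := by
        rw [← fixingSubgroup_fixedField N, ← hHdef, heq]
      exact hσ₁notfix (this ▸ hσ₁N)
    have hfinlt : Module.finrank K H < Module.finrank K K⟮aM⟯ := by
      by_contra hle
      exact hHne (eq_of_le_of_finrank_le hHle (not_lt.mp hle))
    have hfinaM : Module.finrank K K⟮aM⟯ = f.natDegree := by
      rw [adjoin.finrank haMint, hminaM]
    -- ### `H` as a subfield of `Ω`
    set HΩ : Subfield Ω := (IntermediateField.lift H).toSubfield with hHΩ
    have hmemHΩ : ∀ z : Ω, z ∈ HΩ ↔ ∃ y : M, y ∈ H ∧ (y : Ω) = z := by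
      intro z
      constructor
      · rintro ⟨y, hy, rfl⟩; exact ⟨y, hy, rfl⟩
      · rintro ⟨y, hy, rfl⟩; exact ⟨y, hy, rfl⟩
    have hKH : K ≤ HΩ := fun c hc =>
      (hmemHΩ c).mpr ⟨algebraMap K M ⟨c, hc⟩, H.algebraMap_mem _, rfl⟩
    have hHM : ∀ z ∈ HΩ, z ∈ M := fun z hz => by
      obtain ⟨y, -, rfl⟩ := (hmemHΩ z).mp hz; exact y.2
    have hHalg : ∀ z ∈ HΩ, IsAlgebraic K z := fun z hz =>
      ((IsIntegral.of_finite K (⟨z, hHM z hz⟩ : M)).map (IsScalarTower.toAlgHom K M Ω)).isAlgebraic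
    -- `HΩ ≤ C`: elements of `K(a)` are polynomials in `a`
    have hHC : HΩ ≤ C := by
      intro z hz
      obtain ⟨y, hy, rfl⟩ := (hmemHΩ z).mp hz
      have hyKa : y ∈ K⟮aM⟯ := hHle hy
      rw [← mem_toSubalgebra, adjoin_simple_toSubalgebra_of_isAlgebraic haMint.isAlgebraic,
        Algebra.adjoin_singleton_eq_range_aeval] at hyKa
      obtain ⟨q, hq⟩ := hyKa
      have : ((y : M) : Ω) = (q.map (algebraMap K Ω)).eval a := by
        rw [← hq, eval_map, ← aeval_def]
        change (IsScalarTower.toAlgHom K M Ω) (aeval aM q) = _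
        rw [← aeval_algHom_apply]; rfl
      rw [this]
      exact eval_mem_subfield_of_coeff_mem (fun i => by rw [coeff_map]; exact hKC (q.coeff i).2) haC
    -- `HΩ` is perfect, henselian, of rank one
    have hHhens : IsHenselianField HΩ (V.comap (algebraMap HΩ Ω)) :=
      IsHenselianField.of_subfield_algebraic V hKH hHalg hK
    have hHr1 : IsRankOneValued V HΩ := IsRankOneValued.of_algebraic V hKH hr1 hHalg
    have hHperf : ∀ y ∈ HΩ, ∃ b ∈ HΩ, b ^ p = y := forall_exists_pow_eq_of_algebraic p hKH hperf hHalg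
    -- ### the conjugates of `a` over `HΩ` lie within `γ` of `a`
    have hconj : ∀ ρ ∈ (minpoly HΩ a).aroots Ω, V.valuation (a - ρ) ≤ γ := by
      -- `Q = ∏_{σ ∈ N} (X − σ a)` has coefficients in `H` and vanishes at `a`
      set S : Finset (M ≃ₐ[K] M) := Finset.univ.filter (· ∈ N) with hS
      have hmemS : ∀ σ, σ ∈ S ↔ σ ∈ N := fun σ => by simp [hS]
      set QM : Polynomial M := ∏ σ ∈ S, (X - Polynomial.C (σ aM)) with hQM
      have hQMinv : ∀ τ ∈ N, QM.map (τ : M ≃ₐ[K] M).toRingEquiv.toRingHom = QM := by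
        intro τ hτ
        rw [hQM, Polynomial.map_prod]
        simp only [Polynomial.map_sub, map_X, map_C]
        -- reindex by `σ ↦ τ σ`
        refine Finset.prod_equiv (Equiv.mulLeft τ) (fun σ => ?_) (fun σ _ => ?_)
        · rw [hmemS, hmemS, Equiv.coe_mulLeft]
          constructor
          · intro h; exact N.mul_mem hτ h
          · intro h; simpa using N.mul_mem (N.inv_mem hτ) h
        · simp only [Equiv.coe_mulLeft, AlgEquiv.mul_apply]
          rfl
      have hQMcoef : ∀ i, QM.coeff i ∈ H := by
        intro i
        rw [hHdef, mem_fixedField_iff]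
        intro τ hτ
        have h := congrArg (fun P : Polynomial M => P.coeff i) (hQMinv τ hτ)
        simp only [coeff_map] at h
        exact h
      set Q : Polynomial Ω := QM.map (algebraMap M Ω) with hQ
      have hQcoef : ∀ i, Q.coeff i ∈ HΩ := fun i => by
        rw [hQ, coeff_map]; exact (hmemHΩ _).mpr ⟨QM.coeff i, hQMcoef i, rfl⟩
      have hQeval : ∀ z : Ω, Q.eval z = ∏ σ ∈ S, (z - ((σ aM : M) : Ω)) := by
        intro z
        rw [hQ, eval_map, hQM, ← coe_eval₂RingHom, map_prod]
        refine Finset.prod_congr rfl fun σ _ => ?_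
        simp
      have hQa : Q.eval a = 0 := by
        rw [hQeval, Finset.prod_eq_zero_iff]
        exact ⟨1, (hmemS 1).mpr N.one_mem, by rw [AlgEquiv.one_apply]; exact sub_self a⟩
      -- lift `Q` to `HΩ` and divide by the minimal polynomial
      obtain ⟨QH, hQH⟩ : ∃ QH : Polynomial HΩ, QH.map (algebraMap HΩ Ω) = Q :=
        (Polynomial.mem_lifts Q).mp ((Polynomial.lifts_iff_coeff_lifts Q).mpr fun i =>
          ⟨⟨Q.coeff i, hQcoef i⟩, rfl⟩)
      have hQHa : aeval a QH = 0 := by rw [aeval_def, ← eval_map, hQH, hQa]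
      intro ρ hρ
      have hρ' : aeval ρ (minpoly HΩ a) = 0 := (mem_aroots.mp hρ).2
      have hdvd : minpoly HΩ a ∣ QH := minpoly.dvd HΩ a hQHa
      have hQρ : Q.eval ρ = 0 := by
        rw [← hQH, eval_map, ← aeval_def]
        obtain ⟨R, hR⟩ := hdvd
        rw [hR, map_mul, hρ', zero_mul]
      rw [hQeval, Finset.prod_eq_zero_iff] at hQρ
      obtain ⟨σ, hσS, hσ⟩ := hQρ
      rw [sub_eq_zero] at hσ
      rw [hσ, Valuation.map_sub_swap]
      exact (hmemN σ).mp ((hmemS σ).mp hσS)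
    -- ### Prop. 3.1.7 over `HΩ`: an element `c ∈ HΩ` with `|a − c| < |g|`
    have haintH : IsIntegral HΩ a := isIntegral_of_subfield_le hKH (hCalg a haC).isIntegral
    obtain ⟨β₀, hβ₀, -, -, hdist⟩ :=
      exists_conj_krasnerRadius_eq_dist_of_isIntegral_of_perfect V p hHhens hHperf hHr1 haintH
    have hgH : IsAlgebraic HΩ g := isAlgebraic_of_subfield_le hKH hg
    obtain ⟨c, hcH, hc⟩ := hdist g hgH (lt_of_le_of_lt (hconj β₀ hβ₀) hxa)
    -- `|x − c| < |g|`, `c ∈ C`, and `c` has smaller degree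
    have hxc : V.valuation (x - c) < V.valuation g := by
      rw [show x - c = (x - a) + (a - c) by ring]
      exact Valuation.map_add_lt _ hxa hc
    have hcdeg : (minpoly K c).natDegree ≤ n := by
      obtain ⟨y, hy, rfl⟩ := (hmemHΩ c).mp hcH
      have hyint : IsIntegral K y := IsIntegral.of_finite K y
      have h1 : minpoly K (y : Ω) = minpoly K y := by
        rw [show (y : Ω) = algebraMap M Ω y from rfl]
        exact minpoly.algebraMap_eq (algebraMap M Ω).injective y
      have h2 : (minpoly K y).natDegree = Module.finrank K K⟮y⟯ := (adjoin.finrank hyint).symm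
      have h3 : Module.finrank K K⟮y⟯ ≤ Module.finrank K H :=
        finrank_le_of_le_right (adjoin_simple_le_iff.mpr hy)
      have h4 : f.natDegree ≤ n + 1 := hdeg
      rw [h1, h2]
      omega
    exact ih c (hHC hcH) hcdeg hxc

end KrasnerGood


/-! ### Radii from the perfect hull: `v(k)[1/p]` is dense -/

section Radius

variable [IsAlgClosed Ω]

/-- **The values of the perfect hull are dense** (rank one, characteristic `p`): for `k ≤ Ω` with
`(k, V)` of rank one (non-trivially valued) inside `(Ω, V)` of rank one, and elements `z, w` with
`|z| < |w|`, `w ≠ 0`, some `c ≠ 0` in the perfect hull `k^{1/p^∞}` has `|z| < |c| < |w|` — `c` a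
`p`-power root of a power of any `d ∈ k` with `|d| > 1` (the `p`-divisible hull of a non-trivial
rank-one value group is dense). Used to pick the RADIUS of the deep disc among purely inseparable
constants. [folklore] -/
theorem exists_mem_perfectHull_valuation_between (p : ℕ) [hp : Fact p.Prime] [CharP Ω p]
    {k : Subfield Ω} (hk : IsRankOneValued V k)
    (hΩ : IsRankOneValued V (⊤ : Subfield Ω)) {z w : Ω} (hw : w ≠ 0)
    (hzw : V.valuation z < V.valuation w) :
    ∃ c ∈ perfectHull k, c ≠ 0 ∧ V.valuation z < V.valuation c ∧ V.valuation c < V.valuation w := by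
  classical
  haveI : ExpChar Ω p := ExpChar.prime hp.out
  have hexp : ringExpChar Ω = p := ringExpChar.eq Ω p
  have harch : ∀ a b : Ω, 1 < V.valuation a → ∃ n : ℕ, V.valuation b ≤ V.valuation a ^ n :=
    fun a b ha => hΩ.2 a (Subfield.mem_top a) b (Subfield.mem_top b) ha
  obtain ⟨d, hdk, hd1⟩ := hk.1
  have hd0 : d ≠ 0 := by rintro rfl; rw [map_zero] at hd1; exact not_lt_zero hd1
  have hvd0 : V.valuation d ≠ 0 := (_root_.map_ne_zero _).mpr hd0
  have hvw0 : V.valuation w ≠ 0 := (_root_.map_ne_zero _).mpr hw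
  -- `p^e`-th roots of `d` lie in the perfect hull
  have hroot : ∀ e : ℕ, ∃ de : Ω, de ^ p ^ e = d ∧ de ∈ perfectHull k ∧ de ≠ 0 ∧
      1 < V.valuation de := by
    intro e
    obtain ⟨de, hde⟩ := IsAlgClosed.exists_pow_nat_eq d (pow_pos hp.out.pos e)
    have hde0 : de ≠ 0 := by rintro rfl; rw [zero_pow (pow_pos hp.out.pos e).ne'] at hde; exact hd0 hde.symm
    refine ⟨de, hde, (mem_perfectHull_iff' k).mpr ⟨e, by rw [hexp, hde]; exact hdk⟩, hde0, ?_⟩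
    by_contra hle
    push Not at hle
    have : V.valuation d ≤ 1 := by
      rw [← hde, map_pow]; exact pow_le_one₀ zero_le hle
    exact absurd hd1 (not_lt.mpr this)
  by_cases hz : z = 0
  · -- `c = d^{-(N+1)}`
    obtain ⟨N, hN⟩ := harch d w⁻¹ hd1
    refine ⟨(d ^ (N + 1))⁻¹, (perfectHull k).inv_mem ((perfectHull k).pow_mem (le_perfectHull k hdk) _),
      inv_ne_zero (pow_ne_zero _ hd0), ?_, ?_⟩
    · rw [hz, map_zero]
      exact zero_lt_iff.mpr ((_root_.map_ne_zero _).mpr (inv_ne_zero (pow_ne_zero _ hd0)))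
    · rw [map_inv₀, map_pow]
      rw [map_inv₀] at hN
      -- `|w|⁻¹ ≤ |d|^N < |d|^(N+1)`
      have h1 : (V.valuation w)⁻¹ < V.valuation d ^ (N + 1) :=
        lt_of_le_of_lt hN (pow_lt_pow_right₀ hd1 (Nat.lt_succ_self N))
      have hpos : 0 < V.valuation d ^ (N + 1) := pow_pos (zero_lt_iff.mpr hvd0) _
      rw [inv_lt_comm₀ hpos (zero_lt_iff.mpr hvw0)]
      exact h1
  -- `z ≠ 0`: `α = |z| < β = |w|`, `λ = |w/z| > 1`
  have hvz0 : V.valuation z ≠ 0 := (_root_.map_ne_zero _).mpr hz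
  have hlam : 1 < V.valuation (w / z) := by
    rw [map_div₀, one_lt_div₀ (zero_lt_iff.mpr hvz0)]; exact hzw
  -- Step 1: `e` with `u = |d_e| < λ`
  obtain ⟨n, hn⟩ := harch (w / z) d hlam
  obtain ⟨de, hde, hdeP, hde0, hu1⟩ := hroot n
  have hvde0 : V.valuation de ≠ 0 := (_root_.map_ne_zero _).mpr hde0
  have hu : V.valuation de < V.valuation (w / z) := by
    have h1 : V.valuation de ^ p ^ n < V.valuation (w / z) ^ p ^ n := by
      calc V.valuation de ^ p ^ n = V.valuation d := by rw [← map_pow, hde]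
        _ ≤ V.valuation (w / z) ^ n := hn
        _ < V.valuation (w / z) ^ p ^ n := pow_lt_pow_right₀ hlam (Nat.lt_pow_self hp.out.one_lt)
    exact lt_of_pow_lt_pow_left₀ _ zero_le h1
  -- Step 2: the least `m : ℤ` with `α < u^m`
  set u := V.valuation de with hudef
  have hupos : 0 < u := zero_lt_iff.mpr hvde0
  have hP : ∃ m : ℤ, V.valuation z < u ^ m := by
    obtain ⟨N, hN⟩ := harch de z hu1
    refine ⟨(N : ℤ) + 1, lt_of_le_of_lt hN ?_⟩
    rw [← zpow_natCast]
    exact zpow_lt_zpow_right₀ hu1 (by omega)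
  have hbdd : ∃ b : ℤ, ∀ m : ℤ, V.valuation z < u ^ m → b ≤ m := by
    obtain ⟨N, hN⟩ := harch de z⁻¹ hu1
    refine ⟨-(N : ℤ), fun m hm => ?_⟩
    by_contra hlt
    push Not at hlt
    -- `u^m < u^{-N} ≤ |z|`
    have h1 : u ^ m < u ^ (-(N : ℤ)) := zpow_lt_zpow_right₀ hu1 hlt
    have h2 : u ^ (-(N : ℤ)) ≤ V.valuation z := by
      rw [zpow_neg, zpow_natCast, map_inv₀] at *
      rw [inv_le_comm₀ (pow_pos hupos _) (zero_lt_iff.mpr hvz0)]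
      exact hN
    exact absurd hm (not_lt.mpr ((h1.trans_le h2).le))
  obtain ⟨m, hm, hmin⟩ := Int.exists_least_of_bdd hbdd hP
  -- `u^{m-1} ≤ α`, so `u^m ≤ u·α < λ·α = β`
  have hm1 : u ^ (m - 1) ≤ V.valuation z := by
    by_contra hlt
    push Not at hlt
    have := hmin (m - 1) hlt
    omega
  refine ⟨de ^ m, (perfectHull k).zpow_mem hdeP m, zpow_ne_zero m hde0, by rwa [map_zpow₀], ?_⟩
  rw [map_zpow₀]
  have hum : u ^ m = u * u ^ (m - 1) := by
    rw [← zpow_one_add₀ hvde0, add_sub_cancel]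
  rw [hum]
  calc u * u ^ (m - 1) ≤ u * V.valuation z := mul_le_mul_right hm1 _
    _ < V.valuation (w / z) * V.valuation z := mul_lt_mul_of_pos_right hu (zero_lt_iff.mpr hvz0)
    _ = V.valuation w := by rw [map_div₀, div_mul_cancel₀ _ hvz0]

end Radius


/-! ### The disc constants at a finite level (characteristic `p`) -/

section DiscConstants

variable [IsAlgClosed Ω]

/-- Every element of the perfect hull of `k` inside a perfect `Ω` is a `p`-th power there.
[folklore] -/
theorem forall_exists_pow_eq_perfectHull (p : ℕ) [Fact p.Prime] [CharP Ω p] (k : Subfield Ω) :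
    ∀ y ∈ perfectHull k, ∃ b ∈ perfectHull k, b ^ p = y := by
  haveI : PerfectField Ω := IsAlgClosed.perfectField Ω
  haveI : CharP (perfectHull k) p := ((algebraMap (perfectHull k) Ω).charP_iff_charP p).mpr inferInstance
  haveI : ExpChar (perfectHull k) p := ExpChar.prime Fact.out
  intro y hy
  obtain ⟨b, hb⟩ := (PerfectField.toPerfectRing (K := perfectHull k) p).bijective_frobenius.2 ⟨y, hy⟩
  exact ⟨b, b.2, by simpa [frobenius_def] using congrArg Subtype.val hb⟩

/-- **The disc constants of the E-chart, at a finite level** (characteristic `p`; Temkin 2013,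
proof of Thm. 3.2.4, type `4`: "`x` admits a neighborhood isomorphic to a `k′`-disc. By
Corollaries 3.1.8 and 3.1.9, we can take this disc to be an `l`-split disc of an integral radius
for a finite extension `l/k′`", and Thm. 3.2.6, Steps 1–2). Data: `(Ω, V)` algebraically closed of
characteristic `p` = residue characteristic and of rank one, `k ≤ F ≤ Ω` with `k` of rank one,
`|F^×|/|k^×|` torsion, `F̃/k̃` algebraic; `x ∈ F` transcendental over `k`; a finite set `R` of
elements algebraic over `k` (roots to be avoided) and `a₀ ∈ k` (a depth to be exceeded). Then
there are a finite `r ⊆ k^{1/p^∞}`, a CENTRE `a` and a RADIUS `c ∈ r` (a purely inseparable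
constant), and a monic separable polynomial `P` with `P(a) = 0` whose coefficients are
HENSELIAN CONSTANTS of the level (algebraic over `k`, separable over `k(r)`, in `k(r)^h`) — `P`
is the minimal polynomial of `a` over `(k^{1/p^∞})^h` — such that: `a` is algebraic over `k`,
separable over `k(r)` and lies in `(F·k(r))^h`; `|x − a| < |c| < |x − a₀|`; `|c| < |x − ρ|` and
`|c| < |a − ρ| = |x − ρ|` for `ρ ∈ R`; and the disc `|X − a| ≤ |c|` is SPLIT for the centre:
`|c| < |a − ρ|` for every root `ρ ≠ a` of `P` (Krasner; so Newton's iteration for `P` started at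
`x` converges to `a` uniformly on the disc, and `P′` has a unit form there).
[cite: Temkin2013, Thm. 3.2.4 (proof, type 4) with Cor. 3.1.9, Lemma 3.1.3, Prop. 3.1.7;
Thm. 3.2.6 (proof, Steps 1–2)] -/
theorem exists_disc_constants_charP (p : ℕ) [hp : Fact p.Prime] [CharP Ω p]
    [CharP (ResidueField V) p] {k F : Subfield Ω} (hkF : k ≤ F) (hr1 : IsRankOneValued V k)
    (hΩ : IsRankOneValued V (⊤ : Subfield Ω))
    (htors : IsValueTorsionOver V k F) (hres : IsResiduallyAlgebraicOver V k F)
    {x : Ω} (hxF : x ∈ F) (hxt : Transcendental k x)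
    (R : Finset Ω) (hR : ∀ ρ ∈ R, IsAlgebraic k ρ) {a₀ : Ω} (ha₀ : a₀ ∈ k) :
    ∃ (r : Finset Ω) (a c : Ω) (P : Polynomial Ω), (↑r : Set Ω) ⊆ perfectHull k ∧ c ∈ r ∧ c ≠ 0 ∧
      IsAlgebraic k a ∧ IsSeparable (Subfield.closure ((k : Set Ω) ∪ ↑r)) a ∧
      a ∈ henselization V (Subfield.closure ((k : Set Ω) ∪ ↑r ∪ F)) ∧
      P.Monic ∧ P.Separable ∧ P.eval a = 0 ∧
      (∀ i, IsAlgebraic k (P.coeff i) ∧ IsSeparable (Subfield.closure ((k : Set Ω) ∪ ↑r)) (P.coeff i) ∧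
        P.coeff i ∈ henselization V (Subfield.closure ((k : Set Ω) ∪ ↑r))) ∧
      (∀ ρ : Ω, P.IsRoot ρ → ρ ≠ a → V.valuation c < V.valuation (a - ρ)) ∧
      V.valuation (x - a) < V.valuation c ∧ V.valuation c < V.valuation (x - a₀) ∧
      ∀ ρ ∈ R, V.valuation c < V.valuation (x - ρ) ∧ V.valuation c < V.valuation (a - ρ) ∧
        V.valuation (a - ρ) = V.valuation (x - ρ) := by
  classical
  haveI : PerfectField Ω := IsAlgClosed.perfectField Ω
  have hhens := Kuhlmann2010HenselizationIsHenselian_holds.{u}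
  ------------------------------------------------------------ the split base and `K = (k')^h`
  obtain ⟨C, E, hkC, hCE, hFE, hk'C, hEdef, hCalg, hrelk, hrel, hperfC, hC, hE, hr1C, himm⟩ :=
    exists_perfect_split_base V p hkF hr1 htors hres
  set k' : Subfield Ω := perfectHull k with hk'def
  have hkk' : k ≤ k' := le_perfectHull k
  have hk'alg : ∀ a ∈ k', IsAlgebraic k a := fun a ha => isAlgebraic_of_mem_perfectHull k ha
  set K : Subfield Ω := henselization V k' with hKdef
  have hk'K : k' ≤ K := le_henselization V k'
  have hkK : k ≤ K := hkk'.trans hk'K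
  have hKalg : ∀ a ∈ K, IsAlgebraic k a := fun a ha =>
    isAlgebraic_trans_subfield hkk' hk'alg (isSeparable_of_mem_henselization V k' ha).isIntegral.isAlgebraic
  have hKE : K ≤ E := by
    rw [hEdef]; exact henselization_mono V hhens (fun z hz => Subfield.subset_closure (Or.inr hz))
  have hKC : K ≤ C := fun z hz => hrelk z (hKE hz) (hKalg z hz)
  have hK : IsHenselianField K (V.comap (algebraMap K Ω)) := hhens Ω V k'
  have hperfK : ∀ y ∈ K, ∃ b ∈ K, b ^ p = y :=
    forall_exists_pow_eq_of_algebraic p hk'K (forall_exists_pow_eq_perfectHull p k)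
      (fun a ha => (isSeparable_of_mem_henselization V k' ha).isIntegral.isAlgebraic)
  have hr1K : IsRankOneValued V K := IsRankOneValued.of_algebraic V hkK hr1 hKalg
  have hCalgK : ∀ a ∈ C, IsAlgebraic K a := fun a ha => isAlgebraic_of_subfield_le hkK (hCalg a ha)
  haveI : PerfectField K := perfectField_of_forall_exists_pow_eq p hperfK
  ------------------------------------------------------------ Kaplansky for `x`, a deep centre, a Krasner-good one
  obtain ⟨hxC, hval, hres', -, h3⟩ :=
    kaplansky_of_perfect_split_base V p hkC hCE hCalg hrel hperfC hC hE hr1C himm (hFE hxF) hxt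
  obtain ⟨a₁, ha₁C, c₁, hc₁C, hc₁0, hxa₁, hdeep, hfar⟩ :=
    exists_deep_centre V C hxC hval hres' h3 R
      (fun ρ hρ => isAlgebraic_of_subfield_le hkC (hR ρ hρ)) (hkC ha₀)
  obtain ⟨a₂, ha₂C, ha₂⟩ := exists_valuation_sub_lt V C hxC hval hres' ha₁C
  have hxa₂ : V.valuation (x - a₂) < V.valuation c₁ := by rw [← hxa₁]; exact ha₂
  obtain ⟨a, haC, hxa, hkras⟩ :=
    exists_krasnerGood_of_perfect V p hKC hK hperfK hr1K hCalgK (hCalgK c₁ hc₁C)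
      (minpoly K a₂).natDegree a₂ ha₂C le_rfl hxa₂
  have haint : IsIntegral K a := (hCalgK a haC).isIntegral
  ------------------------------------------------------------ the polynomial `P`
  set P : Polynomial Ω := (minpoly K a).map (algebraMap K Ω) with hPdef
  have hPmon : P.Monic := (minpoly.monic haint).map _
  have hPsep : P.Separable :=
    (Polynomial.separable_map _).mpr (PerfectField.separable_of_irreducible (minpoly.irreducible haint))
  have hPa : P.eval a = 0 := by rw [hPdef, eval_map, ← aeval_def]; exact minpoly.aeval K a
  have hPcoefK : ∀ i, P.coeff i ∈ K := fun i => by rw [hPdef, coeff_map]; exact ((minpoly K a).coeff i).2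
  have hP0 : P ≠ 0 := hPmon.ne_zero
  have hProots : ∀ ρ : Ω, P.IsRoot ρ → ρ ∈ (minpoly K a).aroots Ω := fun ρ hρ => by
    rw [mem_aroots]; exact ⟨minpoly.ne_zero haint, by rw [aeval_def, ← eval_map]; exact hρ⟩
  ------------------------------------------------------------ the radius
  -- the bounds: `c₁` and the `a − ρ`, `ρ ≠ a` a root of `P`
  set T : Finset Ω := insert c₁ ((P.roots.toFinset.filter (· ≠ a)).image fun ρ => a - ρ) with hT
  have hTne : T.Nonempty := ⟨c₁, Finset.mem_insert_self _ _⟩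
  obtain ⟨w, hwT, hwmin⟩ := T.exists_min_image (fun z => V.valuation z) hTne
  have hT0 : ∀ z ∈ T, z ≠ 0 := by
    intro z hz
    rcases Finset.mem_insert.mp hz with rfl | hz
    · exact hc₁0
    · obtain ⟨ρ, hρ, rfl⟩ := Finset.mem_image.mp hz
      exact sub_ne_zero.mpr (Ne.symm (Finset.mem_filter.mp hρ).2)
  have hTlt : ∀ z ∈ T, V.valuation (x - a) < V.valuation z := by
    intro z hz
    rcases Finset.mem_insert.mp hz with rfl | hz
    · exact hxa
    · obtain ⟨ρ, hρ, rfl⟩ := Finset.mem_image.mp hz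
      obtain ⟨hρr, hρa⟩ := Finset.mem_filter.mp hρ
      exact hkras ρ (hProots ρ ((mem_roots hP0).mp (Multiset.mem_toFinset.mp hρr))) hρa
  obtain ⟨c, hcP, hc0, hxc, hcw⟩ :=
    exists_mem_perfectHull_valuation_between V p hr1 hΩ (hT0 w hwT) (hTlt w hwT)
  have hcT : ∀ z ∈ T, V.valuation c < V.valuation z := fun z hz => lt_of_lt_of_le hcw (hwmin z hz)
  have hcc₁ : V.valuation c < V.valuation c₁ := hcT c₁ (Finset.mem_insert_self _ _)
  have hcroots : ∀ ρ : Ω, P.IsRoot ρ → ρ ≠ a → V.valuation c < V.valuation (a - ρ) := by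
    intro ρ hρ hρa
    refine hcT (a - ρ) (Finset.mem_insert_of_mem (Finset.mem_image.mpr ⟨ρ, ?_, rfl⟩))
    exact Finset.mem_filter.mpr ⟨Multiset.mem_toFinset.mpr ((mem_roots hP0).mpr hρ), hρa⟩
  ------------------------------------------------------------ descent to a finite level
  -- `a` (with `F`)
  obtain ⟨r₁, hr₁P, hr₁⟩ := exists_finset_level_of_subset_split_base V hCE hEdef hCalg {a}
    (by intro z hz; rw [Finset.coe_singleton, Set.mem_singleton_iff] at hz; rw [hz]; exact haC)
  obtain ⟨haH₁, hasep₁⟩ := hr₁ a (Finset.mem_singleton_self a)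
  -- the coefficients of `P` (constants: without `F`)
  set tP : Finset Ω := (P.support).image P.coeff with htP
  have htPK : ∀ z ∈ tP, z ∈ henselization V (Subfield.closure ((k' : Set Ω) ∪ ∅)) := by
    intro z hz
    obtain ⟨i, -, rfl⟩ := Finset.mem_image.mp hz
    rw [Set.union_empty, Subfield.closure_eq]
    exact hPcoefK i
  obtain ⟨r₂, hr₂P, hr₂⟩ := exists_finset_forall_mem_henselization_closure_levels V hkk' (∅ : Set Ω) tP htPK
  have hsepP : ∀ i, ∃ ri : Finset Ω, (↑ri : Set Ω) ⊆ k' ∧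
      ∀ r' : Finset Ω, (↑ri : Set Ω) ⊆ ↑r' → (↑r' : Set Ω) ⊆ k' →
        IsSeparable (Subfield.closure ((k : Set Ω) ∪ ↑r')) (P.coeff i) :=
    fun i => exists_finset_isSeparable_closure (hKalg _ (hPcoefK i))
  choose ri hriP hri using hsepP
  -- the level
  set r : Finset Ω := insert c (r₁ ∪ r₂ ∪ (P.support).biUnion ri) with hrdef
  have hrP : (↑r : Set Ω) ⊆ k' := by
    intro z hz
    rcases Finset.mem_insert.mp (Finset.mem_coe.mp hz) with rfl | hz
    · exact hcP
    rcases Finset.mem_union.mp hz with hz | hz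
    · rcases Finset.mem_union.mp hz with hz | hz
      · exact hr₁P hz
      · exact hr₂P hz
    · obtain ⟨i, -, hzi⟩ := Finset.mem_biUnion.mp hz
      exact hriP i hzi
  have hr₁r : (↑r₁ : Set Ω) ⊆ ↑r := fun z hz =>
    Finset.mem_insert_of_mem (Finset.mem_union_left _ (Finset.mem_union_left _ hz))
  have hr₂r : (↑r₂ : Set Ω) ⊆ ↑r := fun z hz =>
    Finset.mem_insert_of_mem (Finset.mem_union_left _ (Finset.mem_union_right _ hz))
  have hlevel_mono : ∀ {s : Finset Ω}, (↑s : Set Ω) ⊆ ↑r → ∀ A : Set Ω,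
      henselization V (Subfield.closure ((k : Set Ω) ∪ ↑s ∪ A)) ≤
        henselization V (Subfield.closure ((k : Set Ω) ∪ ↑r ∪ A)) := fun hs A =>
    henselization_mono V hhens (Subfield.closure_mono
      (Set.union_subset_union_left _ (Set.union_subset_union_right _ hs)))
  have hclos_mono : ∀ {s : Finset Ω}, (↑s : Set Ω) ⊆ ↑r →
      Subfield.closure ((k : Set Ω) ∪ ↑s) ≤ Subfield.closure ((k : Set Ω) ∪ ↑r) := fun hs =>
    Subfield.closure_mono (Set.union_subset_union_right _ hs)
  ------------------------------------------------------------ conclusion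
  refine ⟨r, a, c, P, hrP, Finset.mem_insert_self _ _, hc0, hCalg a haC,
    isSeparable_of_subfield_le (hclos_mono hr₁r) hasep₁, hlevel_mono hr₁r (F : Set Ω) haH₁,
    hPmon, hPsep, hPa, fun i => ⟨hKalg _ (hPcoefK i), ?_, ?_⟩, hcroots, hxc,
    lt_trans hcc₁ hdeep, fun ρ hρ => ?_⟩
  · -- separability of the coefficient
    by_cases hi : i ∈ P.support
    · refine hri i r (fun z hz => Finset.mem_insert_of_mem (Finset.mem_union_right _
        (Finset.mem_biUnion.mpr ⟨i, hi, hz⟩))) hrP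
    · rw [Polynomial.notMem_support_iff.mp hi]
      rw [show (0 : Ω) = algebraMap (Subfield.closure ((k : Set Ω) ∪ ↑r)) Ω 0 from (map_zero _).symm]
      exact isSeparable_algebraMap _
  · -- henselian constant at the level
    by_cases hi : i ∈ P.support
    · have h := hr₂ (P.coeff i) (Finset.mem_image_of_mem _ hi)
      have h' := hlevel_mono hr₂r (∅ : Set Ω) h
      rwa [Set.union_empty] at h'
    · rw [Polynomial.notMem_support_iff.mp hi]
      exact Subfield.zero_mem _
  · obtain ⟨h1, -, -⟩ := hfar ρ hρ
    have hcρ : V.valuation c < V.valuation (x - ρ) := lt_trans hcc₁ h1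
    exact ⟨hcρ, valuation_lt_sub_of_valuation_sub_le V hxc.le hcρ⟩

end DiscConstants

end Literature.AlgebraicGeometry.Resolution

end
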